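import Summits.QuantumFields.QCD.Theses.PauliWegnerSea
import Summits.QuantumFields.QCD.Theorems.PauliWegnerSeaOneScaleTrajectoryStubHeavyDecay
import Summits.QuantumFields.QCD.Theorems.PauliWegnerSeaOneScaleTrajectoryStubSignPos
import Literature.MathematicalPhysics.QuantumFieldTheory.QCDFlavourPermutation

/-!
# Line `threshold-tuned-witness` — checked skeleton for crux stmt-QuantumFields-11513
(`Summit.QuantumFields.QCD.Theses.PauliWegnerSea.OneScaleTrajectory`, route PauliWegnerSea, rank 5)

Crux `T`: `∀ N_f ∈ {2,3} ∃ reg : QCDRegularisation N_f` with leading-log mass scaling, two-loop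
asymptotic scaling and, for every renormalised mass tuple `m > 0`, along the bare trajectory
`m_f(k) = m_crit(k) + a_k m_f / Z_m(k)`: (i) `-1 < m_f(k)` eventually; (one-scale) `∀ q ∃ K₀ s`,
eventually a log-shell `ℓ₀` (`1 ≤ ℓ₀ ≤ L_k`, `ℓ₀ a_k ≤ K₀(1+|log a_k|)`) on which the phase-quenched
fractional moment of every quark propagator is `≤ ℓ₀^{-q}(1+|β_k|)^{-q}` on all tori `S ≥ L_k`;
(iii) the lower pin `c₀ e^{-C₁ a_k n}(n+1)^{-p} ≤ E_{|w|,k,S}[(Σ|G_f(0,ne₀)|)^s]`; (iv) sign coherence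
`½ ≤ |∫ det| / ∫ |det|` at side `2L_k+1`.

Line (idea card `Cruxes/OneScaleTrajectory/Ideas/threshold-tuned-witness.md`, merged per
TRIAGE-r1-{1,2,3} with the MONO-free half of `shoot-the-bare-mass`): TUNE THE WITNESS BY A
THRESHOLD. All data of `reg` are explicit except the flavour-blind critical mass, which is DEFINED as
an order-theoretic threshold of the crux's own one-scale functional:

* `a_k := e^{-(k+1)}`, `β_k := afBeta N_f 1 a_k` (asymptotic scaling is an identity),
  `Z_m(k) := (log a_k⁻²)^{γ₀/2β₀}` (mass scaling is an identity), shells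
  `ℓ₀(q,k) := ⌊4(q+1)K(1+|log a_k|)/a_k⌋` (`K > 0` a free THRESHOLD SCALE of the witness — small `K`
  = heavy threshold mass `M_thr ≍ 1/(4K)` in lattice-Λ units), `L_k := ℓ₀(k,k)`, `s := ½`;
* `Certified k t` := the near-degenerate bare tuple `t` obeys EVERY shell bound `q ≤ k` on every
  torus `S ≥ L_k`; `IsGoodFloor k u` := every tuple with all components `≥ u` and spread
  `≤ w_k := k·a_k/Z_m(k)` is certified — an UP-SET IN `u` BY ITS QUANTIFIER (no monotonicity of the
  physics is used; `FMMonotone`'s sea half is numerically false, TRIAGE-r1-3 toy j012589);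
* `m_crit(k) := thrMass k := sInf {u ≥ -1 | IsGoodFloor k u}`.

Then (i) and (one-scale) are THEOREMS OF `sInf` (proved below in `composition`, sorry-free: the
realised tuple has all components strictly above the infimum and spread `a_k·max|m_f − m_g|/Z_m ≤ w_k`
eventually, hence lies above a good floor, hence is certified; `-1 ≤ thrMass` by `le_csInf`), given
only the heavy-mass ANCHOR `anchor` (every positive floor is good eventually — PROVED below from the
tree-vocabulary stub `stub_heavyDecay`, itself the tree's hopping-expansion bound
`norm_inv_diracMatrix_apply_le_of_le` integrated against the `|det|` weight). What is left of the
crux is its physical content at an IMPLICITLY DEFINED LIGHT POINT, in four named stubs: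
`stub_lightPoint` (IR: some bare mass above `-1` is light at coupling `β_k` — else the threshold parks
at the lattice-heavy point `-1⁺`; TRIAGE-r1-2 sharpen (2)), `stub_noJump` (the window / BN2 toll:
lightness persists from just below the threshold to the whole bare window `a_k M/Z_m(k)` above it, for
every flavour — one-sided leading-log running of the quark mass + sea-mass continuity), `stub_transport`
(one-shell-point lightness ⇒ the all-distance, all-volume lower pin (iii); TRIAGE-r1-2/3: lower bounds
do not transport by Hölder), `stub_sign` (clause (iv) on the polylog physical volume
`(8K(k+1)(k+2))⁴` at masses `≥ M_thr`). Every residual stub is asked only for all SUFFICIENTLY SMALL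
threshold scales `K` (`∀ᶠ K in 𝓝[>] 0`: heavy threshold, weak-coupling running), and the composition
intersects the four `K`-filters.

Disproof used (cdisprove cycle 1, evidence notes of 20260815T225733Z-Disproof.lean; no
`_false_without_` theorem exists for this crux): the log room of the one-scale clause is KEPT
(`not_OneScaleTrajectoryPhysicalShell`: physical shells contradict (iii)) — shells sit at
`a_kℓ₀ ≍ 4(q+1)K |log a_k|`; `1 ≤ ℓ₀` is load-bearing (`oneScale_of_shell_zero`) — `K₀(q) = 4(q+1)K`,
not `4qK` (TRIAGE sharpen (1)), and `1 ≤ ℓ₀(q,k)` eventually is PROVED below; lattice-heavy witnesses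
are killed by (iii) (`eventually_mcrit_lt_of_clauseIII`) — here `anchor` gives
`limsup thrMass ≤ 0` and `stub_lightPoint` keeps the threshold off `-1`; `tendsto_beta_atTop` is
consistent with `β_k = afBeta N_f 1 a_k → ∞`.

Registered stubs — CURRENT SHAPE (lead prover-line-stmt-QuantumFields-11513-1, cycle 2, 2026-08-16; history:
planner's five stubs → lead -0 reshaped `stub_anchor` into the tree-vocabulary `stub_heavyDecay` (LANDED p86123)
+ the sorry-free `anchor`; lead -1 split `stub_sign` by the sign of the bare tuple and, after the cycle-2 wave,
reduced each remaining planner stub to a strictly smaller registered KERNEL by sorry-free glue):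
* LANDED, imported: `stub_heavyDecay` (p86123; heavy-mass decay at lattice rate ⇒ `anchor`), `stub_signPos`
  (p96145; clause (iv) at positive tuples = Seiler positivity, ratio `= 1`).
* OPEN (the four registered stubs; each an open lattice-QCD input with NO tree engine — see their docstrings
  for the workers' diagnoses in numbers):
  - `stub_lightBareMass` (TREE vocabulary): some degenerate bare mass `c > -1` has a quark-line `½`-moment
    decaying no faster than a `k`-independent PHYSICAL rate over the asymptotic log range — glue
    `lightPoint_of_lightBareMass` (the light-point race at the top shell) gives the planner's `stub_lightPoint`
    as the theorem `lightPoint`;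
  - `stub_noJumpKernel`: one-sided, volume-uniform, SAME-flavour continuity of log-scale lightness in the bare
    masses at resolution `a_k/Z_m(k)` (BN2 toll) — glue `noJump_of_noJumpKernel` (free input from
    `thrMass = sInf`, rate form of a violated shell bound `exp_le_of_shell_violation`, flavour exchange
    `fm_comp_swap` from the LANDED Literature fact `QCDFlavourPermutation` p97739) gives the planner's
    `stub_noJump` as the theorem `noJump`;
  - `stub_lowerPin`: certified + everywhere-light tuples `> -1` obey the lower pin (iii) — glue
    `transport_of_lowerPin` gives the planner's `stub_transport` as the theorem `transport` (by-product LANDED: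
    Literature `QCDPropagatorNeighbourhoodLowerBound` p98722, the mass-uniform star sum rule at `n ∈ {0,1}`);
  - `stub_signNonpos`: clause (iv) for window tuples with some component `≤ 0` (lead holds it).
  §8 gives each open stub a TREE-VOCABULARY TWIN certified by `Iff.rfl`/congruence (`NoJumpKernelTree`,
  `LowerPinOfShellLight`, `SignNonposTree`; `stub_lightBareMass` is already tree vocabulary), ready to be
  filed as named open inputs. `composition` (planner-stub STATEMENTS ⇒ unfolded crux) is sorry-free and
  case-splits clause (iv) on `∀ f, 0 < m_f(k)`; `OneScaleTrajectory_of` concludes the route decl BY NAME from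
  `anchor`, `lightPoint`, `noJump`, `transport`, `stub_signPos`, `stub_signNonpos`.
-/

noncomputable section

namespace Summit.QuantumFields.QCD.Cruxes.OneScaleTrajectory.ThresholdTunedWitness

open scoped BigOperators Topology
open MeasureTheory Filter Set
open Literature.MathematicalPhysics.QuantumFieldTheory Literature.MathematicalPhysics.QuantumLattice
  Literature.Probability.LatticeModels

/-! ### §0 The crux, re-read (verbatim body; `Iff.rfl`) -/

/-- The four clauses of the crux for a given regularisation `reg` — VERBATIM the text of
`PauliWegnerSea.OneScaleTrajectory` after `∃ reg : QCDRegularisation Nf,`. -/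
def Clauses (Nf : ℕ) (reg : QCDRegularisation Nf) : Prop :=
  reg.HasMassScaling ∧ (reg.scheme 0 0 0).HasAsymptoticScaling ∧ ∀ m : Fin Nf → ℝ, (∀ f, 0 < m f) → (∀ f : Fin Nf, ∀ᶠ k in atTop, -1 < reg.mcrit k + reg.a k * m f / reg.Zm k) ∧ (∀ q : ℕ, ∃ K₀ s : ℝ, 0 < s ∧ s < 1 ∧ ∀ᶠ k in atTop, ∃ ℓ₀ : ℕ, 1 ≤ ℓ₀ ∧ ℓ₀ ≤ reg.L k ∧ (ℓ₀ : ℝ) * reg.a k ≤ K₀ * (1 + |Real.log (reg.a k)|) ∧ ∀ S : ℕ, reg.L k ≤ S → ∀ (f : Fin Nf) (v : Literature.Probability.LatticeModels.Site 4), v ∈ box 4 S → ‖v‖ = (ℓ₀ : ℝ) → (ℓ₀ : ℝ) ^ q * (1 + |reg.β k|) ^ q * ((∫ U : GaugeConfig 4 (2 * S + 1) (Matrix.specialUnitaryGroup (Fin 3) ℂ), ‖(diracMatrix U fun fl => reg.mcrit k + reg.a k * m fl / reg.Zm k).det‖ * (∑ a : Fin 3, ∑ i : Fin 4, ∑ b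 : Fin 3, ∑ j : Fin 4, ‖(diracMatrix U fun fl => reg.mcrit k + reg.a k * m fl / reg.Zm k)⁻¹ (quarkEquiv (f, (Torus.proj (2 * S + 1) 0, a, i))) (quarkEquiv (f, (Torus.proj (2 * S + 1) (v), b, j)))‖) ^ s ∂(wilsonMeasure (fundamentalRep (Fin 3)) (reg.β k))) / (∫ U : GaugeConfig 4 (2 * S + 1) (Matrix.specialUnitaryGroup (Fin 3) ℂ), ‖(diracMatrix U fun fl => reg.mcrit k + reg.a k * m fl / reg.Zm k).det‖ ∂(wilsonMeasure (fundamentalRep (Fin 3)) (reg.β k)))) ≤ 1) ∧ (∃ s c₀ C₁ p : ℝ, 0 < s ∧ s < 1 ∧ 0 < c₀ ∧ ∀ᶠ k in atTop, ∀ S : ℕ, reg.L k ≤ S → ∀ (f : Fin Nf) (n : ℕ), n ≤ S → c₀ * Real.exp (-(C₁ * (reg.a k * n) + p * Real.log (n + 1))) ≤ (∫ U : GaugeConfig 4 (2 * S + 1) (Matrix.specialUnitaryGroup (Fin 3) ℂ), ‖(diracMatrix U fun fl => reg.mcrit k + reg.a k * m fl / reg.Zm k).det‖ * (∑ a : Fin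 3, ∑ i : Fin 4, ∑ b : Fin 3, ∑ j : Fin 4, ‖(diracMatrix U fun fl => reg.mcrit k + reg.a k * m fl / reg.Zm k)⁻¹ (quarkEquiv (f, (Torus.proj (2 * S + 1) 0, a, i))) (quarkEquiv (f, (Torus.proj (2 * S + 1) (Pi.single 0 (n : ℤ)), b, j)))‖) ^ s ∂(wilsonMeasure (fundamentalRep (Fin 3)) (reg.β k))) / (∫ U : GaugeConfig 4 (2 * S + 1) (Matrix.specialUnitaryGroup (Fin 3) ℂ), ‖(diracMatrix U fun fl => reg.mcrit k + reg.a k * m fl / reg.Zm k).det‖ ∂(wilsonMeasure (fundamentalRep (Fin 3)) (reg.β k)))) ∧ (∀ᶠ k in atTop, (1 / 2 : ℝ) ≤ ‖∫ U : GaugeConfig 4 (2 * reg.L k + 1) (Matrix.specialUnitaryGroup (Fin 3) ℂ), (diracMatrix U fun fl => reg.mcrit k + reg.a k * m fl / reg.Zm k).det ∂(wilsonMeasure (fundamentalRep (Fin 3)) (reg.β k))‖ / (∫ U : GaugeConfig 4 (2 * reg.L k + 1) (Matrix.specialUnitaryGroup (Fin 3) ℂ), ‖(diracMatrix U fun fl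 => reg.mcrit k + reg.a k * m fl / reg.Zm k).det‖ ∂(wilsonMeasure (fundamentalRep (Fin 3)) (reg.β k))))

/-- The crux, re-read through `Clauses` (definitional). -/
theorem oneScaleTrajectory_iff :
    Summit.QuantumFields.QCD.Theses.PauliWegnerSea.OneScaleTrajectory ↔
      ∀ Nf : ℕ, Nf = 2 ∨ Nf = 3 → ∃ reg : QCDRegularisation Nf, Clauses Nf reg :=
  Iff.rfl

/-! ### §1 The explicit data of the threshold witness -/

/-- Lattice spacings `a_k := e^{-(k+1)}` (so `|log a_k| = k+1`, `log a_k⁻² = 2(k+1)`). -/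
def aSeq (k : ℕ) : ℝ := Real.exp (-((k : ℝ) + 1))

/-- Inverse bare couplings on the two-loop profile with `Λ_lat = 1`: asymptotic scaling by fiat. -/
def betaSeq (Nf k : ℕ) : ℝ := afBeta Nf 1 (aSeq k)

/-- The canonical mass renormalisation `Z_m(k) := (log a_k⁻²)^{γ₀/(2β₀)}`: mass scaling by fiat. -/
def zmSeq (Nf k : ℕ) : ℝ := Real.log (1 / aSeq k ^ 2) ^ massExponent Nf

/-- The log-shell radii `ℓ₀(q,k) := ⌊4(q+1)K(1+|log a_k|)/a_k⌋` (`K₀(q) := 4(q+1)K`; the `+1` keeps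
`1 ≤ ℓ₀` at `q = 0`, TRIAGE sharpen (1) / Disproof `oneScale_of_shell_zero`). -/
def shellRadius (K : ℝ) (q k : ℕ) : ℕ :=
  ⌊4 * ((q : ℝ) + 1) * K * (1 + |Real.log (aSeq k)|) / aSeq k⌋₊

/-- Torus half-sides `L_k := ℓ₀(k,k)` (the outermost certified shell; physical side
`a_k(2L_k+1) ≈ 8K(k+1)(k+2)`, polylogarithmic in `1/a_k`). -/
def volSeq (K : ℝ) (k : ℕ) : ℕ := shellRadius K k k

/-- Slab width `w_k := k · a_k / Z_m(k)`: the admissible bare-mass spread of the tuples the threshold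
certifies (`k = |log a_k| - 1` times the window scale `a_k/Z_m(k)`; it dominates
`a_k · max|m_f - m_g| / Z_m(k)` eventually for every fixed `m`). -/
def slabWidth (Nf k : ℕ) : ℝ := (k : ℝ) * aSeq k / zmSeq Nf k

/-- The phase-quenched fractional moment of the flavour-`f` quark propagator from `0` to `v` on the
torus of side `2S+1` at inverse coupling `β` and bare masses `mq` — VERBATIM the functional of the
one-scale clause and of clause (iii) of the crux, with `(β, mq, s)` free. -/
def fm (Nf : ℕ) (β : ℝ) (mq : Fin Nf → ℝ) (S : ℕ) (f : Fin Nf)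
    (v : Literature.Probability.LatticeModels.Site 4) (s : ℝ) : ℝ :=
  (∫ U : GaugeConfig 4 (2 * S + 1) (Matrix.specialUnitaryGroup (Fin 3) ℂ),
      ‖(diracMatrix U mq).det‖ *
        (∑ a : Fin 3, ∑ i : Fin 4, ∑ b : Fin 3, ∑ j : Fin 4,
          ‖(diracMatrix U mq)⁻¹ (quarkEquiv (f, (Torus.proj (2 * S + 1) 0, a, i)))
            (quarkEquiv (f, (Torus.proj (2 * S + 1) v, b, j)))‖) ^ s
      ∂(wilsonMeasure (fundamentalRep (Fin 3)) β)) /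
    (∫ U : GaugeConfig 4 (2 * S + 1) (Matrix.specialUnitaryGroup (Fin 3) ℂ),
      ‖(diracMatrix U mq).det‖ ∂(wilsonMeasure (fundamentalRep (Fin 3)) β))

/-! ### §2 The threshold -/

/-- `Certified K k t`: the bare tuple `t` obeys EVERY shell bound `q ≤ k` of the one-scale clause
(exponent `s = ½`, coupling `β_k`) on EVERY torus `S ≥ L_k`:
`ℓ₀(q,k)^q (1+|β_k|)^q · E_{|w|,S}[(Σ|G_f(0,v)|)^{1/2}] ≤ 1` for all flavours and all `‖v‖_∞ = ℓ₀(q,k)`.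
Roughly: every flavour of `t` has lattice decay rate `≥ (1+o(1)) a_k/(4K)`, i.e. is `M_thr`-HEAVY. -/
def Certified (Nf : ℕ) (K : ℝ) (k : ℕ) (t : Fin Nf → ℝ) : Prop :=
  ∀ q : ℕ, q ≤ k → ∀ S : ℕ, volSeq K k ≤ S →
    ∀ (f : Fin Nf) (v : Literature.Probability.LatticeModels.Site 4), v ∈ box 4 S →
      ‖v‖ = (shellRadius K q k : ℝ) →
        (shellRadius K q k : ℝ) ^ q * (1 + |betaSeq Nf k|) ^ q *
            fm Nf (betaSeq Nf k) t S f v (1 / 2) ≤ 1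

/-- `IsGoodFloor K k u`: every bare tuple with all components `≥ u` and spread `≤ w_k` is certified.
An UP-SET in `u` by its quantifier (`isGoodFloor_mono`). -/
def IsGoodFloor (Nf : ℕ) (K : ℝ) (k : ℕ) (u : ℝ) : Prop :=
  ∀ t : Fin Nf → ℝ, (∀ f, u ≤ t f) → (∀ f g, |t f - t g| ≤ slabWidth Nf k) → Certified Nf K k t

/-- The set of good floors on the physical branch `u ≥ -1`. -/
def floorSet (Nf : ℕ) (K : ℝ) (k : ℕ) : Set ℝ := {u | -1 ≤ u ∧ IsGoodFloor Nf K k u}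

/-- THE THRESHOLD `m_crit(k) := inf {u ≥ -1 | IsGoodFloor k u}` — the flavour-blind critical bare
mass of the witness, defined by DECAY of the crux's own functional, never by symmetry (so the Aoki
question does not arise: a bare mass inside an Aoki finger or on a massless line is light, hence a
bad floor, hence below the threshold). Junk value `0` while the floor set is empty (finitely many `k`,
`anchor`). -/
def thrMass (Nf : ℕ) (K : ℝ) (k : ℕ) : ℝ := sInf (floorSet Nf K k)

/-! ### §3 Elementary facts about the data (sorry-free) -/

theorem aSeq_pos (k : ℕ) : 0 < aSeq k := Real.exp_pos _

theorem log_aSeq (k : ℕ) : Real.log (aSeq k) = -((k : ℝ) + 1) := Real.log_exp _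

theorem abs_log_aSeq (k : ℕ) : |Real.log (aSeq k)| = (k : ℝ) + 1 := by
  rw [log_aSeq, abs_neg, abs_of_nonneg (by positivity)]

theorem aSeq_lt_one (k : ℕ) : aSeq k < 1 := by
  rw [aSeq]
  have : (0 : ℝ) ≤ (k : ℝ) := by positivity
  exact Real.exp_lt_one_iff.2 (by linarith)

theorem aSeq_le_one (k : ℕ) : aSeq k ≤ 1 := (aSeq_lt_one k).le

theorem tendsto_aSeq : Tendsto aSeq atTop (𝓝 0) := by
  have h : Tendsto (fun k : ℕ => (k : ℝ) + 1) atTop atTop :=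
    tendsto_atTop_add_const_right _ 1 tendsto_natCast_atTop_atTop
  exact Real.tendsto_exp_neg_atTop_nhds_zero.comp h

theorem log_inv_sq_aSeq (k : ℕ) : Real.log (1 / aSeq k ^ 2) = 2 * ((k : ℝ) + 1) := by
  rw [one_div, Real.log_inv, Real.log_pow, log_aSeq]
  push_cast
  ring

theorem log_inv_sq_aSeq_pos (k : ℕ) : 0 < Real.log (1 / aSeq k ^ 2) := by
  rw [log_inv_sq_aSeq]; positivity

theorem zmSeq_pos (Nf k : ℕ) : 0 < zmSeq Nf k :=
  Real.rpow_pos_of_pos (log_inv_sq_aSeq_pos k) _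

theorem slabWidth_nonneg (Nf k : ℕ) : 0 ≤ slabWidth Nf k := by
  unfold slabWidth
  exact div_nonneg (mul_nonneg (by positivity) (aSeq_pos k).le) (zmSeq_pos Nf k).le

/-- The shells are nested outward in `q`. -/
theorem shellRadius_mono {K : ℝ} (hK : 0 ≤ K) {q q' : ℕ} (h : q ≤ q') (k : ℕ) :
    shellRadius K q k ≤ shellRadius K q' k := by
  unfold shellRadius
  apply Nat.floor_mono
  apply div_le_div_of_nonneg_right _ (aSeq_pos k).le
  have hq : (q : ℝ) ≤ q' := by exact_mod_cast h
  have h1 : 0 ≤ 1 + |Real.log (aSeq k)| := by positivity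
  nlinarith [mul_nonneg hK h1]

/-- The log room: `ℓ₀(q,k) · a_k ≤ K₀(q) (1 + |log a_k|)` with `K₀(q) = 4(q+1)K`. -/
theorem shellRadius_mul_aSeq_le {K : ℝ} (hK : 0 ≤ K) (q k : ℕ) :
    (shellRadius K q k : ℝ) * aSeq k ≤ 4 * ((q : ℝ) + 1) * K * (1 + |Real.log (aSeq k)|) := by
  have ha := aSeq_pos k
  have hx : 0 ≤ 4 * ((q : ℝ) + 1) * K * (1 + |Real.log (aSeq k)|) / aSeq k := by positivity
  have hfl : (shellRadius K q k : ℝ) ≤ 4 * ((q : ℝ) + 1) * K * (1 + |Real.log (aSeq k)|) / aSeq k :=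
    Nat.floor_le hx
  calc (shellRadius K q k : ℝ) * aSeq k
      ≤ 4 * ((q : ℝ) + 1) * K * (1 + |Real.log (aSeq k)|) / aSeq k * aSeq k :=
        mul_le_mul_of_nonneg_right hfl ha.le
    _ = 4 * ((q : ℝ) + 1) * K * (1 + |Real.log (aSeq k)|) := div_mul_cancel₀ _ ha.ne'

/-- `1 ≤ ℓ₀(q,k)` eventually (Disproof: `1 ≤ ℓ₀` is load-bearing). -/
theorem eventually_one_le_shellRadius {K : ℝ} (hK : 0 < K) (q : ℕ) :
    ∀ᶠ k in atTop, 1 ≤ shellRadius K q k := by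
  have h4K : (0 : ℝ) < 4 * K := by positivity
  filter_upwards [tendsto_aSeq.eventually (eventually_le_nhds h4K)] with k hk
  have ha := aSeq_pos k
  unfold shellRadius
  apply Nat.le_floor
  rw [Nat.cast_one, le_div_iff₀ ha, one_mul]
  have h1 : 1 ≤ 1 + |Real.log (aSeq k)| := le_add_of_nonneg_right (abs_nonneg _)
  have h2 : (1 : ℝ) ≤ (q : ℝ) + 1 := le_add_of_nonneg_left (by positivity)
  calc aSeq k ≤ 4 * K := hk
    _ = 4 * 1 * K * 1 := by ring
    _ ≤ 4 * ((q : ℝ) + 1) * K * (1 + |Real.log (aSeq k)|) := by gcongr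

/-- `a_k L_k → ∞` (the volumes are super-logarithmic: `a_k L_k ≥ 4(k+1)K(k+2) - 1`). -/
theorem tendsto_aSeq_mul_volSeq {K : ℝ} (hK : 0 < K) :
    Tendsto (fun k => aSeq k * (volSeq K k : ℝ)) atTop atTop := by
  have h2K : (0 : ℝ) < 2 * K := by positivity
  have hg : Tendsto (fun k : ℕ => 2 * K * (k : ℝ)) atTop atTop :=
    Tendsto.const_mul_atTop h2K tendsto_natCast_atTop_atTop
  refine tendsto_atTop_mono' atTop ?_ hg
  filter_upwards [tendsto_natCast_atTop_atTop.eventually_ge_atTop (1 / (2 * K))] with k hk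
  have ha := aSeq_pos k
  have ha1 := aSeq_le_one k
  have hk1 : 1 ≤ 2 * K * (k : ℝ) := by
    have := (div_le_iff₀ h2K).mp hk
    linarith
  set X : ℝ := 4 * ((k : ℝ) + 1) * K * (1 + |Real.log (aSeq k)|) with hX
  have hXa : 0 ≤ X / aSeq k := by positivity
  have hfl : X / aSeq k < (volSeq K k : ℝ) + 1 := by
    unfold volSeq shellRadius
    exact Nat.lt_floor_add_one _
  have hL : X - aSeq k ≤ aSeq k * (volSeq K k : ℝ) := by
    have := mul_le_mul_of_nonneg_left hfl.le ha.le
    rw [mul_div_cancel₀ _ ha.ne', mul_add, mul_one] at this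
    linarith
  have hXge : 4 * ((k : ℝ) + 1) * K ≤ X := by
    rw [hX, abs_log_aSeq]
    have : (1 : ℝ) ≤ 1 + ((k : ℝ) + 1) := by linarith
    calc 4 * ((k : ℝ) + 1) * K = 4 * ((k : ℝ) + 1) * K * 1 := by ring
      _ ≤ 4 * ((k : ℝ) + 1) * K * (1 + ((k : ℝ) + 1)) := by gcongr
  have hKk : 0 ≤ K := hK.le
  nlinarith

theorem isGoodFloor_mono {Nf : ℕ} {K : ℝ} {k : ℕ} {u u' : ℝ} (h : u ≤ u')
    (hu : IsGoodFloor Nf K k u) : IsGoodFloor Nf K k u' :=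
  fun t ht hsp => hu t (fun f => h.trans (ht f)) hsp

theorem floorSet_bddBelow (Nf : ℕ) (K : ℝ) (k : ℕ) : BddBelow (floorSet Nf K k) :=
  ⟨-1, fun _ hu => hu.1⟩

/-- Clause (i) at the threshold: `-1 ≤ m_crit(k)` as soon as some floor is good. -/
theorem neg_one_le_thrMass {Nf : ℕ} {K : ℝ} {k : ℕ} (hne : (floorSet Nf K k).Nonempty) :
    -1 ≤ thrMass Nf K k :=
  le_csInf hne fun _ hu => hu.1

/-- A bad floor bounds the threshold from below (up-set). -/
theorem le_thrMass_of_not_isGoodFloor {Nf : ℕ} {K : ℝ} {k : ℕ} (hne : (floorSet Nf K k).Nonempty)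
    {x : ℝ} (hx : ¬ IsGoodFloor Nf K k x) : x ≤ thrMass Nf K k := by
  refine le_csInf hne fun u hu => ?_
  by_contra h
  exact hx (isGoodFloor_mono (not_le.mp h).le hu.2)

/-- THE LEVER (order logic): a near-degenerate tuple all of whose components lie strictly above the
threshold is certified — it lies above a good floor. No monotonicity of the physics is used. -/
theorem certified_of_thrMass_lt {Nf : ℕ} {K : ℝ} {k : ℕ} (hne : (floorSet Nf K k).Nonempty)
    {t : Fin Nf → ℝ} (ht : ∀ f, thrMass Nf K k < t f)
    (hsp : ∀ f g, |t f - t g| ≤ slabWidth Nf k) : Certified Nf K k t := by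
  classical
  rcases isEmpty_or_nonempty (Fin Nf) with hE | hN
  · intro q _ S _ f
    exact (IsEmpty.false f).elim
  · obtain ⟨f₀, hf₀⟩ := Finite.exists_min t
    obtain ⟨u, hu, hut⟩ := exists_lt_of_csInf_lt hne (ht f₀)
    exact hu.2 t (fun f => hut.le.trans (hf₀ f)) hsp

/-! ### §4 The threshold witness -/

/-- THE THRESHOLD WITNESS `reg_thr(K)`: `(a_k, β_k, L_k, m_crit := thrMass, Z_m)` as in §1–§2. -/
def thrReg (Nf : ℕ) (K : ℝ) (hK : 0 < K) : QCDRegularisation Nf where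
  a := aSeq
  a_pos := aSeq_pos
  tendsto_a := tendsto_aSeq
  β := betaSeq Nf
  L := volSeq K
  tendsto_L := tendsto_aSeq_mul_volSeq hK
  mcrit := thrMass Nf K
  Zm := zmSeq Nf
  Zm_pos := zmSeq_pos Nf

/-- Mass scaling of the witness is an identity (`Z_m(k) / (log a_k⁻²)^{γ₀/2β₀} ≡ 1`). -/
theorem thrReg_hasMassScaling (Nf : ℕ) (K : ℝ) (hK : 0 < K) : (thrReg Nf K hK).HasMassScaling := by
  refine ⟨1, one_pos, tendsto_const_nhds.congr' (Eventually.of_forall fun k => ?_)⟩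
  show (1 : ℝ) = zmSeq Nf k / zmSeq Nf k
  exact (div_self (zmSeq_pos Nf k).ne').symm

/-- Asymptotic scaling of the witness is an identity (`β_k - afBeta N_f 1 a_k ≡ 0`). -/
theorem thrReg_hasAsymptoticScaling (Nf : ℕ) (K : ℝ) (hK : 0 < K) :
    ((thrReg Nf K hK).scheme 0 0 0).HasAsymptoticScaling := by
  refine ⟨1, one_pos, tendsto_const_nhds.congr' (Eventually.of_forall fun k => ?_)⟩
  show (0 : ℝ) = betaSeq Nf k - afBeta Nf 1 (aSeq k)
  rw [betaSeq, sub_self]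

/-! ### §5 Currencies of the residual stubs -/

/-- `ShellLight K k R t f`: flavour `f` of the bare tuple `t` is `R`-LIGHT at the log scale — on some
torus `S ≥ L_k`, at some point `v` between the innermost and the outermost shell
(`ℓ₀(0,k) ≤ ‖v‖_∞ ≤ L_k`), its phase-quenched fractional moment is at least `e^{-R a_k ‖v‖_∞}`
(physical decay rate `≤ R`). The negation of a shell bound is of this form with `R = (1+o(1))/(4K)`. -/
def ShellLight (Nf : ℕ) (K : ℝ) (k : ℕ) (R : ℝ) (t : Fin Nf → ℝ) (f : Fin Nf) : Prop :=
  ∃ S : ℕ, volSeq K k ≤ S ∧ ∃ v : Literature.Probability.LatticeModels.Site 4, v ∈ box 4 S ∧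
    (shellRadius K 0 k : ℝ) ≤ ‖v‖ ∧ ‖v‖ ≤ (volSeq K k : ℝ) ∧
      Real.exp (-(R * (aSeq k * ‖v‖))) ≤ fm Nf (betaSeq Nf k) t S f v (1 / 2)

/-! ### §6 The registered stubs -/

/-! `stub_heavyDecay` — **HEAVY-MASS DECAY OF THE PHASE-QUENCHED FRACTIONAL MOMENT AT LATTICE RATE**
(tree vocabulary; lead's reshape 2026-08-16 of the planner's `stub_anchor`): LANDED as
`Summits/QuantumFields/QCD/Theorems/PauliWegnerSeaOneScaleTrajectoryStubHeavyDecay.lean` (p86123, accepted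
2026-08-16, commit 92e2de181785) and IMPORTED above — the registered theorem
`Summit.QuantumFields.QCD.Cruxes.OneScaleTrajectory.ThresholdTunedWitness.stub_heavyDecay` is used below by name.
Statement: for bare masses `m_f ≥ m₀ > 0`, every `β`, torus `2S+1`, flavour `f`, `v ∈ box S`,
`E_{|w|,β,S}[(Σ_{a,i,b,j}|G_f(0,v)|)^{1/2}] ≤ (144/m₀)^{1/2} · exp(-½ log((m₀+4)/4) · ‖v‖_∞)`. -/

/-! #### Glue for the anchor (sorry-free): `stub_heavyDecay` ⇒ the planner's `stub_anchor` -/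

/-- `fm ≤ (144/m₀)^{1/2} e^{-c(m₀)‖v‖}` for bare masses `≥ m₀ > 0` (`stub_heavyDecay`, re-read through `fm`). -/
theorem fm_le_of_heavy {Nf : ℕ} {m₀ : ℝ} (hm₀ : 0 < m₀) (β : ℝ) {mq : Fin Nf → ℝ}
    (hM : ∀ f, m₀ ≤ mq f) (S : ℕ) (f : Fin Nf) {v : Literature.Probability.LatticeModels.Site 4}
    (hv : v ∈ box 4 S) :
    fm Nf β mq S f v (1 / 2) ≤
      (144 / m₀) ^ (1 / 2 : ℝ) * Real.exp (-(Real.log ((m₀ + 4) / 4) / 2 * ‖v‖)) :=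
  stub_heavyDecay Nf m₀ hm₀ β mq hM S f v hv

/-- The growth constant of the coupling: `1 + |β_k| ≤ betaGrowth N_f · (k+1)`. -/
def betaGrowth (Nf : ℕ) : ℝ := 1 + 4 * |betaCoeff₀ Nf| + 4 * |betaCoeff₁ Nf / betaCoeff₀ Nf|

theorem one_le_betaGrowth (Nf : ℕ) : 1 ≤ betaGrowth Nf := by
  unfold betaGrowth
  have h0 := abs_nonneg (betaCoeff₀ Nf)
  have h1 := abs_nonneg (betaCoeff₁ Nf / betaCoeff₀ Nf)
  linarith

/-- `1 + |β_k| ≤ betaGrowth N_f · (k+1)` (`β_k = 4b₀(k+1) + 2(b₁/b₀) log(2(k+1))`). -/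
theorem one_add_abs_betaSeq_le (Nf k : ℕ) :
    1 + |betaSeq Nf k| ≤ betaGrowth Nf * ((k : ℝ) + 1) := by
  have hk1 : (1 : ℝ) ≤ (k : ℝ) + 1 := le_add_of_nonneg_left (Nat.cast_nonneg k)
  have hlog : Real.log (1 / (aSeq k ^ 2 * (1 : ℝ) ^ 2)) = 2 * ((k : ℝ) + 1) := by
    rw [one_pow, mul_one, log_inv_sq_aSeq]
  have hL0 : 0 ≤ Real.log (2 * ((k : ℝ) + 1)) := Real.log_nonneg (by linarith)
  have hL1 : Real.log (2 * ((k : ℝ) + 1)) ≤ 2 * ((k : ℝ) + 1) :=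
    (Real.log_le_sub_one_of_pos (by linarith)).trans (by linarith)
  have e1 : betaSeq Nf k = 2 * betaCoeff₀ Nf * (2 * ((k : ℝ) + 1)) +
      2 * (betaCoeff₁ Nf / betaCoeff₀ Nf) * Real.log (2 * ((k : ℝ) + 1)) := by
    unfold betaSeq afBeta
    rw [hlog]
  have t1 : |2 * betaCoeff₀ Nf * (2 * ((k : ℝ) + 1))| = 4 * |betaCoeff₀ Nf| * ((k : ℝ) + 1) := by
    rw [show 2 * betaCoeff₀ Nf * (2 * ((k : ℝ) + 1)) = betaCoeff₀ Nf * (4 * ((k : ℝ) + 1)) by ring,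
      abs_mul, abs_of_nonneg (by positivity : (0 : ℝ) ≤ 4 * ((k : ℝ) + 1))]
    ring
  have t2 : |2 * (betaCoeff₁ Nf / betaCoeff₀ Nf) * Real.log (2 * ((k : ℝ) + 1))| ≤
      4 * |betaCoeff₁ Nf / betaCoeff₀ Nf| * ((k : ℝ) + 1) := by
    rw [abs_mul, abs_mul, abs_of_nonneg hL0, abs_of_pos (two_pos : (0 : ℝ) < 2)]
    nlinarith [abs_nonneg (betaCoeff₁ Nf / betaCoeff₀ Nf), hL1]
  have hβ : |betaSeq Nf k| ≤
      (4 * |betaCoeff₀ Nf| + 4 * |betaCoeff₁ Nf / betaCoeff₀ Nf|) * ((k : ℝ) + 1) := by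
    rw [e1]
    refine (abs_add_le _ _).trans ?_
    rw [t1]
    linarith
  unfold betaGrowth
  nlinarith [abs_nonneg (betaCoeff₀ Nf), abs_nonneg (betaCoeff₁ Nf / betaCoeff₀ Nf)]

theorem inv_aSeq (k : ℕ) : (aSeq k)⁻¹ = Real.exp ((k : ℝ) + 1) := by
  rw [aSeq, ← Real.exp_neg, neg_neg]

/-- Upper size of the shells: `ℓ₀(q,k) ≤ 4(q+1)K(k+2)e^{k+1}`. -/
theorem shellRadius_le {K : ℝ} (hK : 0 ≤ K) (q k : ℕ) :
    (shellRadius K q k : ℝ) ≤ 4 * ((q : ℝ) + 1) * K * ((k : ℝ) + 2) * Real.exp ((k : ℝ) + 1) := by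
  have hx : 0 ≤ 4 * ((q : ℝ) + 1) * K * (1 + |Real.log (aSeq k)|) / aSeq k := by
    have := aSeq_pos k; positivity
  refine (Nat.floor_le hx).trans_eq ?_
  rw [abs_log_aSeq, div_eq_mul_inv, inv_aSeq]
  ring

/-- Lower size of the shells: `4K(k+2)e^{k+1} - 1 ≤ ℓ₀(q,k)`. -/
theorem shellRadius_ge {K : ℝ} (hK : 0 ≤ K) (q k : ℕ) :
    4 * K * ((k : ℝ) + 2) * Real.exp ((k : ℝ) + 1) - 1 ≤ (shellRadius K q k : ℝ) := by
  have hlt := Nat.lt_floor_add_one (4 * ((q : ℝ) + 1) * K * (1 + |Real.log (aSeq k)|) / aSeq k)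
  have heq : 4 * ((q : ℝ) + 1) * K * (1 + |Real.log (aSeq k)|) / aSeq k =
      4 * ((q : ℝ) + 1) * K * ((k : ℝ) + 2) * Real.exp ((k : ℝ) + 1) := by
    rw [abs_log_aSeq, div_eq_mul_inv, inv_aSeq]; ring
  have hq : (1 : ℝ) ≤ (q : ℝ) + 1 := le_add_of_nonneg_left (Nat.cast_nonneg q)
  have hpos : 0 ≤ 4 * K * ((k : ℝ) + 2) * Real.exp ((k : ℝ) + 1) := by positivity
  have h1 : 4 * K * ((k : ℝ) + 2) * Real.exp ((k : ℝ) + 1) ≤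
      4 * ((q : ℝ) + 1) * K * (1 + |Real.log (aSeq k)|) / aSeq k := by
    rw [heq]; nlinarith
  unfold shellRadius
  linarith

/-- `(k+2)²/4 ≤ e^{k+1}`. -/
theorem sq_div_four_le_exp (k : ℕ) : ((k : ℝ) + 2) ^ 2 / 4 ≤ Real.exp ((k : ℝ) + 1) := by
  have h := Real.add_one_le_exp (((k : ℝ) + 1) / 2)
  have h0 : 0 ≤ ((k : ℝ) + 1) / 2 + 1 := by positivity
  have h2 : (((k : ℝ) + 1) / 2 + 1) ^ 2 ≤ Real.exp (((k : ℝ) + 1) / 2) ^ 2 := pow_le_pow_left₀ h0 h 2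
  rw [← Real.exp_nat_mul] at h2
  have h3 : ((2 : ℕ) : ℝ) * (((k : ℝ) + 1) / 2) = (k : ℝ) + 1 := by push_cast; ring
  rw [h3] at h2
  nlinarith

/-- **The doubly-exponential race** (pure real analysis): for `k` large, UNIFORMLY in `q ≤ k`,
`ℓ₀(q,k)^q (1+|β_k|)^q · C e^{-c ℓ₀(q,k)} ≤ 1` — polynomial-in-`e^{O(k²)}` losses against decay at a fixed
lattice rate across `ℓ₀ ≳ K k e^{k}` lattice units. -/
theorem eventually_shellProduct_le_one {K c C : ℝ} (hK : 0 < K) (hc : 0 < c) (hC : 0 < C) (Nf : ℕ) :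
    ∀ᶠ k in atTop, ∀ q : ℕ, q ≤ k →
      (shellRadius K q k : ℝ) ^ q * (1 + |betaSeq Nf k|) ^ q *
        (C * Real.exp (-(c * (shellRadius K q k : ℝ)))) ≤ 1 := by
  set A : ℝ := betaGrowth Nf with hA
  have hA1 : 1 ≤ A := one_le_betaGrowth Nf
  -- the polynomial budget `E (k+2)²` against `c K (k+2)³`
  set E : ℝ := 4 * K * A + 4 + 2 + C + c with hE
  have hEpos : 0 < E := by positivity
  filter_upwards [eventually_ge_atTop ⌈E / (c * K)⌉₊, eventually_one_le_shellRadius hK 0] with k hk h1 q hq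
  have hkr : E / (c * K) ≤ (k : ℝ) := (Nat.le_ceil _).trans (by exact_mod_cast hk)
  have hcK : 0 < c * K := mul_pos hc hK
  have hEk : E ≤ c * K * (k : ℝ) := by rwa [div_le_iff₀' hcK] at hkr
  set X : ℝ := (shellRadius K q k : ℝ) with hX
  set B : ℝ := 1 + |betaSeq Nf k| with hB
  have hX1 : 1 ≤ X := by
    rw [hX]; exact_mod_cast h1.trans (shellRadius_mono hK.le (Nat.zero_le q) k)
  have hB1 : 1 ≤ B := by rw [hB]; exact le_add_of_nonneg_right (abs_nonneg _)
  have hqk : (q : ℝ) + 1 ≤ (k : ℝ) + 1 := by exact_mod_cast Nat.succ_le_succ hq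
  have hk0 : (0 : ℝ) ≤ k := Nat.cast_nonneg k
  -- sizes
  have hXhi : X ≤ 4 * ((k : ℝ) + 1) * K * ((k : ℝ) + 2) * Real.exp ((k : ℝ) + 1) := by
    refine (shellRadius_le hK.le q k).trans ?_
    have : 0 ≤ K * ((k : ℝ) + 2) * Real.exp ((k : ℝ) + 1) := by positivity
    nlinarith
  have hXlo : 4 * K * ((k : ℝ) + 2) * Real.exp ((k : ℝ) + 1) - 1 ≤ X := shellRadius_ge hK.le q k
  have hBhi : B ≤ A * ((k : ℝ) + 1) := one_add_abs_betaSeq_le Nf k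
  -- Step 1: `X^q B^q ≤ (X B)^k`
  have hpow : X ^ q * B ^ q ≤ (X * B) ^ k := by
    rw [mul_pow]
    exact mul_le_mul (pow_le_pow_right₀ hX1 hq) (pow_le_pow_right₀ hB1 hq) (by positivity)
      (by positivity)
  -- Step 2: `X B ≤ exp(4KA + 4k + 2)`
  have he1 : (k : ℝ) + 1 ≤ Real.exp (k : ℝ) := Real.add_one_le_exp _
  have he2 : (k : ℝ) + 2 ≤ Real.exp ((k : ℝ) + 1) := by
    have := Real.add_one_le_exp ((k : ℝ) + 1); linarith
  have he3 : 4 * K * A ≤ Real.exp (4 * K * A) := by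
    have := Real.add_one_le_exp (4 * K * A); linarith
  have hXB : X * B ≤ Real.exp (4 * K * A + 4 * (k : ℝ) + 2) := by
    have hprod : X * B ≤ (4 * K * A) * ((k : ℝ) + 1) * ((k : ℝ) + 2) * Real.exp ((k : ℝ) + 1) *
        ((k : ℝ) + 1) := by
      calc X * B ≤ (4 * ((k : ℝ) + 1) * K * ((k : ℝ) + 2) * Real.exp ((k : ℝ) + 1)) *
            (A * ((k : ℝ) + 1)) :=
            mul_le_mul hXhi hBhi (by positivity) (by positivity)
        _ = _ := by ring
    refine hprod.trans ?_
    have hsplit : Real.exp (4 * K * A + 4 * (k : ℝ) + 2) =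
        Real.exp (4 * K * A) * Real.exp (k : ℝ) * Real.exp ((k : ℝ) + 1) *
          Real.exp ((k : ℝ) + 1) * Real.exp (k : ℝ) := by
      simp only [← Real.exp_add]; ring_nf
    rw [hsplit]
    have hKA : 0 ≤ 4 * K * A := by positivity
    exact mul_le_mul (mul_le_mul (mul_le_mul (mul_le_mul he3 he1 (by positivity) (by positivity))
      he2 (by positivity) (by positivity)) le_rfl (by positivity) (by positivity)) he1
      (by positivity) (by positivity)
  -- Step 3: `(X B)^k ≤ exp(k (4KA + 4k + 2))`
  have hXBk : (X * B) ^ k ≤ Real.exp ((k : ℝ) * (4 * K * A + 4 * (k : ℝ) + 2)) := by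
    rw [Real.exp_nat_mul]
    exact pow_le_pow_left₀ (by positivity) hXB k
  -- Step 4: `C ≤ exp C`, assemble the exponent
  have hCexp : C ≤ Real.exp C := by have := Real.add_one_le_exp C; linarith
  have hmain : X ^ q * B ^ q * (C * Real.exp (-(c * X))) ≤
      Real.exp ((k : ℝ) * (4 * K * A + 4 * (k : ℝ) + 2) + C - c * X) := by
    rw [show (k : ℝ) * (4 * K * A + 4 * (k : ℝ) + 2) + C - c * X =
        (k : ℝ) * (4 * K * A + 4 * (k : ℝ) + 2) + C + -(c * X) by ring, Real.exp_add, Real.exp_add]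
    have h0 : 0 ≤ Real.exp (-(c * X)) := (Real.exp_pos _).le
    calc X ^ q * B ^ q * (C * Real.exp (-(c * X)))
        ≤ (X * B) ^ k * (C * Real.exp (-(c * X))) :=
          mul_le_mul_of_nonneg_right hpow (by positivity)
      _ ≤ Real.exp ((k : ℝ) * (4 * K * A + 4 * (k : ℝ) + 2)) * (Real.exp C * Real.exp (-(c * X))) :=
          mul_le_mul hXBk (mul_le_mul_of_nonneg_right hCexp h0) (by positivity) (by positivity)
      _ = _ := by ring
  refine hmain.trans ?_
  rw [Real.exp_le_one_iff]
  -- Step 5: the exponent is `≤ E (k+2)² - c K (k+2)³ ≤ 0`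
  have hKA : 0 ≤ 4 * K * A := by positivity
  have hpoly : (k : ℝ) * (4 * K * A + 4 * (k : ℝ) + 2) + C + c ≤ E * ((k : ℝ) + 2) ^ 2 := by
    rw [hE]
    nlinarith [mul_nonneg hKA (by positivity : (0 : ℝ) ≤ (k : ℝ) ^ 2 + 3 * (k : ℝ) + 4),
      mul_nonneg (add_nonneg hC.le hc.le) (by positivity : (0 : ℝ) ≤ (k : ℝ) ^ 2 + 4 * (k : ℝ) + 3)]
  have hX3 : c * K * ((k : ℝ) + 2) ^ 3 - c ≤ c * X := by
    have h4 : 4 * K * ((k : ℝ) + 2) * (((k : ℝ) + 2) ^ 2 / 4) ≤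
        4 * K * ((k : ℝ) + 2) * Real.exp ((k : ℝ) + 1) :=
      mul_le_mul_of_nonneg_left (sq_div_four_le_exp k) (by positivity)
    have h5 : c * (4 * K * ((k : ℝ) + 2) * Real.exp ((k : ℝ) + 1) - 1) ≤ c * X :=
      mul_le_mul_of_nonneg_left hXlo hc.le
    nlinarith
  have hfin : E * ((k : ℝ) + 2) ^ 2 ≤ c * K * ((k : ℝ) + 2) ^ 3 := by
    have hE2 : E ≤ c * K * ((k : ℝ) + 2) := hEk.trans (by nlinarith)
    calc E * ((k : ℝ) + 2) ^ 2 ≤ (c * K * ((k : ℝ) + 2)) * ((k : ℝ) + 2) ^ 2 :=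
          mul_le_mul_of_nonneg_right hE2 (by positivity)
      _ = c * K * ((k : ℝ) + 2) ^ 3 := by ring
  linarith

/-- `anchor` (the planner's `stub_anchor`, statement verbatim) — **HEAVY-MASS ANCHOR**, now a THEOREM of
`stub_heavyDecay` (glue = `eventually_shellProduct_le_one`): every POSITIVE bare-mass floor `m₀` is good
eventually in `k`, for every `K > 0` and every `N_f` — all tuples `≥ m₀` (any spread) obey every shell bound
`q ≤ k` on every torus `S ≥ L_k`, because `fm ≤ (144/m₀)^{1/2} e^{-c(m₀) ℓ₀(q,k)}` with the LATTICE rate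
`c(m₀) = ½ log((m₀+4)/4) > 0` while `ℓ₀(q,k)^q (1+|β_k|)^q = e^{O(k²)}` and `ℓ₀(q,k) ≥ 4K(k+2)e^{k+1} - 1`.
Consequence used by `composition`: the floor set is non-empty (so `-1 ≤ thrMass ≤ m₀`) eventually; with
`m₀ ↓ 0` it records `limsup_k thrMass k ≤ 0` (Disproof `eventually_mcrit_lt_of_clauseIII` moral, by construction). -/
theorem anchor :
    ∀ (Nf : ℕ) (K : ℝ), 0 < K → ∀ m₀ : ℝ, 0 < m₀ → ∀ᶠ k in atTop, m₀ ∈ floorSet Nf K k := by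
  intro Nf K hK m₀ hm₀
  have hc : 0 < Real.log ((m₀ + 4) / 4) / 2 :=
    div_pos (Real.log_pos (by rw [lt_div_iff₀ (by norm_num : (0 : ℝ) < 4)]; linarith)) two_pos
  have hC : 0 < (144 / m₀) ^ (1 / 2 : ℝ) := Real.rpow_pos_of_pos (by positivity) _
  filter_upwards [eventually_shellProduct_le_one hK hc hC Nf] with k hk
  refine ⟨by linarith, fun t ht _ q hq S _ f v hv hnorm => ?_⟩
  have hfm := fm_le_of_heavy hm₀ (betaSeq Nf k) ht S f hv
  rw [hnorm] at hfm
  have h0 : 0 ≤ (shellRadius K q k : ℝ) ^ q * (1 + |betaSeq Nf k|) ^ q := by positivity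
  calc (shellRadius K q k : ℝ) ^ q * (1 + |betaSeq Nf k|) ^ q * fm Nf (betaSeq Nf k) t S f v (1 / 2)
      ≤ (shellRadius K q k : ℝ) ^ q * (1 + |betaSeq Nf k|) ^ q *
          ((144 / m₀) ^ (1 / 2 : ℝ) *
            Real.exp (-(Real.log ((m₀ + 4) / 4) / 2 * (shellRadius K q k : ℝ)))) :=
        mul_le_mul_of_nonneg_left hfm h0
    _ ≤ 1 := hk q hq

/-! #### `stub_lightPoint`: tree-vocabulary core + sorry-free glue
(stub-worker of lead prover-line-stmt-QuantumFields-11513-1, 2026-08-16)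

`stub_lightPoint` is an open input about the INTERACTING phase-quenched lattice theory: it asks a
LOWER bound on `E_{|w|,β_k,S}[(Σ|G_f(0,v)|)^{1/2}]` at a separation `‖v‖_∞ = ℓ₀(q,k) ≍ K k e^{k}` for SOME
bare mass above `-1`.  The tree has exactly one lower bound on this functional, the diagonal pin
`phaseQuenched_diagMoment_ge_of_pos` (`v = 0`, `m > 0`); no engine reaches `v ≠ 0` (gauge invariance
kills every linear functional of `G(0,v)`, `E[G(0,v)] = 0`; the hopping series is an UPPER bound and
lives at `m > 0`, where the lattice rate `log((m+4)/4)·½` is far above the allowance `a_k/(4K)`; the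
route decls `IntegerCriticalLine.CriticalLineExists` (quenched, resolvent at `η > 0`, negation of a
UNIFORM bound — no located scale) and `QuarkMassMonotone.*` (upper bounds / gaps only) do not imply it).
Below, its MINIMAL TREE-VOCABULARY CORE `stub_lightBareMass` — "a hadron of BOUNDED PHYSICAL MASS exists
somewhere on the Wilson bare axis above the doubler point": along `a_k = e^{-(k+1)}`,
`β_k = afBeta N_f 1 a_k`, there are `R, p, A > 0` such that for every `ε > 0`, eventually in `k`, some
DEGENERATE bare tuple `(c,…,c)`, `c > -1`, has `A (n+1)^{-p} e^{-R a_k n} ≤ E_{|w|,β_k,S}[(Σ|G_f(0, n e₀)|)^{1/2}]`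
at every separation `n` in the ASYMPTOTIC log range `a_k n ∈ [ε, 1]·(k+1)(k+2)` (physical distances
`≍ |log a_k|² → ∞` only: no UV / short-distance content) on arbitrarily large tori `S ≥ max(S₀, n)` —
and the sorry-free glue `lightPoint_of_lightBareMass` (pure real analysis at
the TOP shell `q = k`, `v = L_k e₀`: the tolerance `L_k^{-k}(1+|β_k|)^{-k} ≤ e^{-k(k+1)}` absorbs any
physical rate `R` once `K ≤ 1/(8R)`, since `R a_k L_k ≤ 4RK(k+1)(k+2) ≤ (k+1)(k+2)/2`). -/

/-- `‖n e₀‖_∞ = n` on `ℤ⁴`. -/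
theorem norm_single_natCast (n : ℕ) :
    ‖(Pi.single 0 (n : ℤ) : Literature.Probability.LatticeModels.Site 4)‖ = (n : ℝ) := by
  rw [Pi.norm_single, Int.norm_natCast]

/-- `n e₀ ∈ box S` for `n ≤ S`. -/
theorem single_natCast_mem_box {n S : ℕ} (h : n ≤ S) :
    (Pi.single 0 (n : ℤ) : Literature.Probability.LatticeModels.Site 4) ∈ box 4 S := by
  rw [mem_box]
  intro i
  by_cases hi : i = 0
  · subst hi
    rw [Pi.single_eq_same]
    omega
  · rw [Pi.single_eq_of_ne hi]
    omega

/-- The exponent bookkeeping of the light-point race: for `k ≥ 2 + 6p + |2 + 4p - 2 log A|` (and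
`k ≥ 1`), `k(k+1) - (k+1)(k+2)/2 - p(3k+2) > -log A`. -/
theorem lightRace_exponent {k p lA : ℝ} (hk1 : 1 ≤ k)
    (hkE : 2 + 6 * p + |2 + 4 * p - 2 * lA| ≤ k) :
    -lA < k * (k + 1) - ((k + 1) * (k + 2) / 2 + p * (3 * k + 2)) := by
  have habs := le_abs_self (2 + 4 * p - 2 * lA)
  have hk2 : k * (2 + 6 * p + |2 + 4 * p - 2 * lA|) ≤ k * k :=
    mul_le_mul_of_nonneg_left hkE (by linarith)
  have hkc : 0 ≤ (k - 1) * |2 + 4 * p - 2 * lA| := mul_nonneg (by linarith) (abs_nonneg _)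
  nlinarith [hk2, hkc, habs]

/-- **The light-point race** (pure real analysis): for `1 ≤ R`, `R K ≤ 1/8`, `0 ≤ p`, `0 < A`,
eventually in `k` the top shell `L_k = ℓ₀(k,k)` sits at physical distance
`a_k L_k ∈ [2K(k+1)(k+2), (k+1)(k+2)]` and `L_k^k (1+|β_k|)^k · A e^{-(R a_k L_k + p log(L_k+1))} > 1`
(`L_k ≥ e^{k+1}` gives `L_k^k ≥ e^{k(k+1)}`, while `R a_k L_k ≤ (k+1)(k+2)/2` and `log(L_k+1) ≤ 3k+2`). -/
theorem eventually_lightRace {K R p A : ℝ} (hK : 0 < K) (hR : 1 ≤ R) (hKR : R * K ≤ 1 / 8)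
    (hp : 0 ≤ p) (hA : 0 < A) (Nf : ℕ) :
    ∀ᶠ (k : ℕ) in atTop,
      2 * K * (((k : ℝ) + 1) * ((k : ℝ) + 2)) ≤ aSeq k * (volSeq K k : ℝ) ∧
      aSeq k * (volSeq K k : ℝ) ≤ ((k : ℝ) + 1) * ((k : ℝ) + 2) ∧
      1 < (volSeq K k : ℝ) ^ k * (1 + |betaSeq Nf k|) ^ k *
        (A * Real.exp (-(R * (aSeq k * (volSeq K k : ℝ)) +
          p * Real.log ((volSeq K k : ℝ) + 1)))) := by
  set c₀ : ℝ := 2 + 4 * p - 2 * Real.log A with hc₀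
  set E : ℝ := 2 + 6 * p + |c₀| with hE
  have h4K : (0 : ℝ) < 4 * K := by positivity
  filter_upwards [tendsto_natCast_atTop_atTop.eventually_ge_atTop (1 / (2 * K)),
    eventually_ge_atTop ⌈E⌉₊, eventually_ge_atTop 1,
    tendsto_aSeq.eventually (eventually_le_nhds h4K)] with k hk1 hkE hk1' ha4K
  have hk0 : (0 : ℝ) ≤ k := Nat.cast_nonneg k
  have hkone : (1 : ℝ) ≤ k := by exact_mod_cast hk1'
  have hkE' : E ≤ (k : ℝ) := (Nat.le_ceil _).trans (by exact_mod_cast hkE)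
  have ha := aSeq_pos k
  have hK8 : K ≤ 1 / 8 := by nlinarith
  set X : ℝ := (volSeq K k : ℝ) with hX
  set B : ℝ := 1 + |betaSeq Nf k| with hB
  -- sizes of the top shell
  have hXlo : 4 * K * ((k : ℝ) + 2) * Real.exp ((k : ℝ) + 1) - 1 ≤ X := shellRadius_ge hK.le k k
  have hXhi : X ≤ 4 * ((k : ℝ) + 1) * K * ((k : ℝ) + 2) * Real.exp ((k : ℝ) + 1) :=
    shellRadius_le hK.le k k
  have hXa : X * aSeq k ≤ 4 * ((k : ℝ) + 1) * K * ((k : ℝ) + 2) := by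
    have := shellRadius_mul_aSeq_le hK.le k k
    rwa [abs_log_aSeq, show (1 : ℝ) + ((k : ℝ) + 1) = (k : ℝ) + 2 by ring] at this
  have h2K : 2 ≤ 4 * K * ((k : ℝ) + 2) := by
    have h2 : 1 ≤ 2 * K * (k : ℝ) := by
      have := (div_le_iff₀ (by positivity : (0 : ℝ) < 2 * K)).mp hk1
      linarith
    nlinarith
  have he1 : 1 ≤ Real.exp ((k : ℝ) + 1) := Real.one_le_exp (by positivity)
  have hXexp : Real.exp ((k : ℝ) + 1) ≤ X := by
    have : 2 * Real.exp ((k : ℝ) + 1) ≤ 4 * K * ((k : ℝ) + 2) * Real.exp ((k : ℝ) + 1) :=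
      mul_le_mul_of_nonneg_right h2K (Real.exp_pos _).le
    linarith
  have hXpos : 0 < X := (Real.exp_pos _).trans_le hXexp
  -- first conjunct: `2K(k+1)(k+2) ≤ a_k L_k` (sharp size of the TOP shell)
  have hkk0 : 0 ≤ ((k : ℝ) + 1) * ((k : ℝ) + 2) := by positivity
  have hkk2 : 2 ≤ ((k : ℝ) + 1) * ((k : ℝ) + 2) := by nlinarith
  have hprod : aSeq k * Real.exp ((k : ℝ) + 1) = 1 := by
    rw [aSeq, ← Real.exp_add, neg_add_cancel, Real.exp_zero]
  have hXlo' : 4 * ((k : ℝ) + 1) * K * ((k : ℝ) + 2) * Real.exp ((k : ℝ) + 1) - 1 ≤ X := by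
    have hfl : 4 * ((k : ℝ) + 1) * K * (1 + |Real.log (aSeq k)|) / aSeq k < X + 1 := by
      rw [hX]; unfold volSeq shellRadius; exact Nat.lt_floor_add_one _
    have heq : 4 * ((k : ℝ) + 1) * K * (1 + |Real.log (aSeq k)|) / aSeq k =
        4 * ((k : ℝ) + 1) * K * ((k : ℝ) + 2) * Real.exp ((k : ℝ) + 1) := by
      rw [abs_log_aSeq, div_eq_mul_inv, inv_aSeq]; ring
    rw [heq] at hfl
    linarith
  have h1 : 2 * K * (((k : ℝ) + 1) * ((k : ℝ) + 2)) ≤ aSeq k * X := by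
    have h1a : aSeq k * (4 * ((k : ℝ) + 1) * K * ((k : ℝ) + 2) * Real.exp ((k : ℝ) + 1) - 1) ≤
        aSeq k * X := mul_le_mul_of_nonneg_left hXlo' ha.le
    have h1b : aSeq k * (4 * ((k : ℝ) + 1) * K * ((k : ℝ) + 2) * Real.exp ((k : ℝ) + 1) - 1) =
        4 * K * (((k : ℝ) + 1) * ((k : ℝ) + 2)) - aSeq k := by
      have : aSeq k * (4 * ((k : ℝ) + 1) * K * ((k : ℝ) + 2) * Real.exp ((k : ℝ) + 1) - 1) =
          4 * K * (((k : ℝ) + 1) * ((k : ℝ) + 2)) * (aSeq k * Real.exp ((k : ℝ) + 1)) - aSeq k := by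
        ring
      rw [this, hprod, mul_one]
    have h1c : aSeq k ≤ 2 * K * (((k : ℝ) + 1) * ((k : ℝ) + 2)) := by nlinarith
    linarith
  -- second conjunct: `a_k L_k ≤ (k+1)(k+2)/2`
  have h2 : aSeq k * X ≤ ((k : ℝ) + 1) * ((k : ℝ) + 2) / 2 := by
    rw [mul_comm]
    refine hXa.trans ?_
    nlinarith
  refine ⟨h1, by linarith, ?_⟩
  -- third conjunct: the race
  have hRaX : R * (aSeq k * X) ≤ ((k : ℝ) + 1) * ((k : ℝ) + 2) / 2 := by
    calc R * (aSeq k * X) = R * (X * aSeq k) := by ring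
      _ ≤ R * (4 * ((k : ℝ) + 1) * K * ((k : ℝ) + 2)) :=
          mul_le_mul_of_nonneg_left hXa (by linarith)
      _ = 4 * (R * K) * (((k : ℝ) + 1) * ((k : ℝ) + 2)) := by ring
      _ ≤ 4 * (1 / 8) * (((k : ℝ) + 1) * ((k : ℝ) + 2)) := by gcongr
      _ = ((k : ℝ) + 1) * ((k : ℝ) + 2) / 2 := by ring
  have hlogX : Real.log (X + 1) ≤ 3 * (k : ℝ) + 2 := by
    have hk1e : (k : ℝ) + 1 ≤ Real.exp (k : ℝ) := Real.add_one_le_exp _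
    have hk2e : (k : ℝ) + 2 ≤ Real.exp ((k : ℝ) + 1) := by
      have := Real.add_one_le_exp ((k : ℝ) + 1); linarith
    have hprod : ((k : ℝ) + 1) * ((k : ℝ) + 2) * Real.exp ((k : ℝ) + 1) ≤
        Real.exp (k : ℝ) * Real.exp ((k : ℝ) + 1) * Real.exp ((k : ℝ) + 1) :=
      mul_le_mul_of_nonneg_right (mul_le_mul hk1e hk2e (by positivity) (by positivity))
        (Real.exp_pos _).le
    have hsplit : Real.exp (3 * (k : ℝ) + 2) =
        Real.exp (k : ℝ) * Real.exp ((k : ℝ) + 1) * Real.exp ((k : ℝ) + 1) := by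
      simp only [← Real.exp_add]; ring_nf
    have hX1' : X + 1 ≤ ((k : ℝ) + 1) * ((k : ℝ) + 2) * Real.exp ((k : ℝ) + 1) := by
      have h0 : 0 ≤ ((k : ℝ) + 1) * ((k : ℝ) + 2) * Real.exp ((k : ℝ) + 1) := by positivity
      have hh : 4 * ((k : ℝ) + 1) * K * ((k : ℝ) + 2) * Real.exp ((k : ℝ) + 1) ≤
          ((k : ℝ) + 1) * ((k : ℝ) + 2) * Real.exp ((k : ℝ) + 1) / 2 := by nlinarith
      have hh2 : 2 ≤ ((k : ℝ) + 1) * ((k : ℝ) + 2) * Real.exp ((k : ℝ) + 1) := by nlinarith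
      linarith
    have hX1 : X + 1 ≤ Real.exp (3 * (k : ℝ) + 2) := by rw [hsplit]; exact hX1'.trans hprod
    have := Real.log_le_log (by linarith) hX1
    rwa [Real.log_exp] at this
  -- lower bounds of the three factors
  have hXk : Real.exp ((k : ℝ) * ((k : ℝ) + 1)) ≤ X ^ k := by
    rw [Real.exp_nat_mul]
    exact pow_le_pow_left₀ (Real.exp_pos _).le hXexp k
  have hB1 : 1 ≤ B := le_add_of_nonneg_right (abs_nonneg _)
  have hBk : 1 ≤ B ^ k := one_le_pow₀ hB1
  have hexp : Real.exp (-(((k : ℝ) + 1) * ((k : ℝ) + 2) / 2 + p * (3 * (k : ℝ) + 2))) ≤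
      Real.exp (-(R * (aSeq k * X) + p * Real.log (X + 1))) := by
    rw [Real.exp_le_exp]
    have := mul_le_mul_of_nonneg_left hlogX hp
    linarith
  -- the exponent race
  set Y : ℝ := (k : ℝ) * ((k : ℝ) + 1) -
    (((k : ℝ) + 1) * ((k : ℝ) + 2) / 2 + p * (3 * (k : ℝ) + 2)) with hY
  have hYpos : -Real.log A < Y := by
    rw [hY]
    apply lightRace_exponent hkone
    rw [← hc₀, ← hE]
    exact hkE'
  have hAY : 1 < A * Real.exp Y := by
    have : Real.exp (-Real.log A) < Real.exp Y := Real.exp_lt_exp.2 hYpos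
    rw [Real.exp_neg, Real.exp_log hA] at this
    calc (1 : ℝ) = A * A⁻¹ := (mul_inv_cancel₀ hA.ne').symm
      _ < A * Real.exp Y := mul_lt_mul_of_pos_left this hA
  calc (1 : ℝ) < A * Real.exp Y := hAY
    _ = Real.exp ((k : ℝ) * ((k : ℝ) + 1)) * 1 *
          (A * Real.exp (-(((k : ℝ) + 1) * ((k : ℝ) + 2) / 2 + p * (3 * (k : ℝ) + 2)))) := by
        rw [hY, sub_eq_add_neg, Real.exp_add]; ring
    _ ≤ X ^ k * B ^ k * (A * Real.exp (-(R * (aSeq k * X) + p * Real.log (X + 1)))) :=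
        mul_le_mul (mul_le_mul hXk hBk zero_le_one (by positivity))
          (mul_le_mul_of_nonneg_left hexp hA.le) (by positivity) (by positivity)

/-- `stub_lightBareMass` — **THE TREE-VOCABULARY CORE OF `stub_lightPoint`: A BARE MASS OF BOUNDED
PHYSICAL CORRELATION LENGTH EXISTS ABOVE THE DOUBLER POINT** (proposed reshape, stub-worker 2026-08-16;
OPEN lattice-QCD input, no tree engine). For `N_f ∈ {2,3}` there are a physical rate `R`, a power `p`
and an amplitude `A > 0` such that, along `a_k = e^{-(k+1)}`, `β_k = afBeta N_f 1 a_k` (two-loop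
profile, `Λ_lat = 1`), for every `ε > 0`, eventually in `k` SOME degenerate bare tuple `(c,…,c)` with
`c > -1` has, at every separation `n` in the asymptotic log range
`ε (k+1)(k+2) ≤ a_k n ≤ (k+1)(k+2) = |log a_k|(1+|log a_k|)` (physical distances `→ ∞`) and on
arbitrarily large tori `2S+1` (`S ≥ S₀`, `S ≥ n`), for some flavour,
`A (n+1)^{-p} e^{-R a_k n} ≤ E_{|w|,β_k,S}[(Σ_{a,i,b,j}|G_f((0,a,i),(n e₀,b,j))|)^{1/2}]`
— the phase-quenched quark-line `½`-moment decays no faster than a `k`-INDEPENDENT physical rate.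
Physically: light hadrons exist on the Wilson bare axis at weak coupling in every scenario (continuous
chiral line, Sharpe–Singleton first-order branch with `m_PS,min ≍ a_kΛ²`, Aoki phase), and `|G|² ~` the
pion correlator; rigorously: nothing (an existence statement about the interacting theory near
`κ_c(β_k)`, `β_k → ∞`; for `N_f = 2` degenerate the weight `det² ≥ 0` is the honest RP measure, Lüscher
1977 positivity holds exactly for `κ < 1/6 ⟺ m > -1`, so log-convexity of RP correlators would reduce it
to SHORT-distance near-free behaviour of the pion correlator plus a moment comparison — still open). -/
theorem stub_lightBareMass :
    ∀ Nf : ℕ, Nf = 2 ∨ Nf = 3 → ∃ R p A : ℝ, 0 < A ∧ ∀ ε : ℝ, 0 < ε →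
      ∀ᶠ (k : ℕ) in atTop, ∃ c : ℝ, -1 < c ∧
      ∀ n S₀ : ℕ, ε * (((k : ℝ) + 1) * ((k : ℝ) + 2)) ≤ Real.exp (-((k : ℝ) + 1)) * n →
        Real.exp (-((k : ℝ) + 1)) * n ≤ ((k : ℝ) + 1) * ((k : ℝ) + 2) →
          ∃ S : ℕ, S₀ ≤ S ∧ n ≤ S ∧ ∃ f : Fin Nf,
            A * Real.exp (-(R * (Real.exp (-((k : ℝ) + 1)) * n) + p * Real.log (n + 1))) ≤
              (∫ U : GaugeConfig 4 (2 * S + 1) (Matrix.specialUnitaryGroup (Fin 3) ℂ),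
                  ‖(diracMatrix U (fun _ : Fin Nf => c)).det‖ *
                    (∑ a : Fin 3, ∑ i : Fin 4, ∑ b : Fin 3, ∑ j : Fin 4,
                      ‖(diracMatrix U (fun _ : Fin Nf => c))⁻¹
                          (quarkEquiv (f, (Torus.proj (2 * S + 1) 0, a, i)))
                          (quarkEquiv (f, (Torus.proj (2 * S + 1) (Pi.single 0 (n : ℤ)), b, j)))‖) ^
                      (1 / 2 : ℝ)
                  ∂(wilsonMeasure (fundamentalRep (Fin 3)) (afBeta Nf 1 (Real.exp (-((k : ℝ) + 1)))))) /
                (∫ U : GaugeConfig 4 (2 * S + 1) (Matrix.specialUnitaryGroup (Fin 3) ℂ),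
                  ‖(diracMatrix U (fun _ : Fin Nf => c)).det‖
                  ∂(wilsonMeasure (fundamentalRep (Fin 3)) (afBeta Nf 1 (Real.exp (-((k : ℝ) + 1)))))) := by
  sorry

/-- **Glue (sorry-free): `stub_lightBareMass` ⇒ `stub_lightPoint`.** For `K ≤ 1/(8 max(R,1))` and
`k` large, the degenerate tuple `(c,…,c)` of `stub_lightBareMass` violates the TOP shell bound `q = k`
at the axis point `v = L_k e₀` (`‖v‖_∞ = L_k = ℓ₀(k,k)`, `v ∈ box S`) of the torus it supplies with
`S ≥ L_k`: `L_k^k(1+|β_k|)^k · fm ≥ L_k^k · A e^{-(R a_k L_k + p log(L_k+1))} > 1`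
(`eventually_lightRace`); so `c` is a bad floor (the degenerate tuple has spread `0 ≤ w_k`). -/
theorem lightPoint_of_lightBareMass
    (h : ∀ Nf : ℕ, Nf = 2 ∨ Nf = 3 → ∃ R p A : ℝ, 0 < A ∧ ∀ ε : ℝ, 0 < ε →
      ∀ᶠ (k : ℕ) in atTop, ∃ c : ℝ, -1 < c ∧
      ∀ n S₀ : ℕ, ε * (((k : ℝ) + 1) * ((k : ℝ) + 2)) ≤ Real.exp (-((k : ℝ) + 1)) * n →
        Real.exp (-((k : ℝ) + 1)) * n ≤ ((k : ℝ) + 1) * ((k : ℝ) + 2) →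
          ∃ S : ℕ, S₀ ≤ S ∧ n ≤ S ∧ ∃ f : Fin Nf,
            A * Real.exp (-(R * (Real.exp (-((k : ℝ) + 1)) * n) + p * Real.log (n + 1))) ≤
              (∫ U : GaugeConfig 4 (2 * S + 1) (Matrix.specialUnitaryGroup (Fin 3) ℂ),
                  ‖(diracMatrix U (fun _ : Fin Nf => c)).det‖ *
                    (∑ a : Fin 3, ∑ i : Fin 4, ∑ b : Fin 3, ∑ j : Fin 4,
                      ‖(diracMatrix U (fun _ : Fin Nf => c))⁻¹
                          (quarkEquiv (f, (Torus.proj (2 * S + 1) 0, a, i)))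
                          (quarkEquiv (f, (Torus.proj (2 * S + 1) (Pi.single 0 (n : ℤ)), b, j)))‖) ^
                      (1 / 2 : ℝ)
                  ∂(wilsonMeasure (fundamentalRep (Fin 3)) (afBeta Nf 1 (Real.exp (-((k : ℝ) + 1)))))) /
                (∫ U : GaugeConfig 4 (2 * S + 1) (Matrix.specialUnitaryGroup (Fin 3) ℂ),
                  ‖(diracMatrix U (fun _ : Fin Nf => c)).det‖
                  ∂(wilsonMeasure (fundamentalRep (Fin 3)) (afBeta Nf 1 (Real.exp (-((k : ℝ) + 1))))))) :
    ∀ Nf : ℕ, Nf = 2 ∨ Nf = 3 → ∀ᶠ K in 𝓝[>] (0 : ℝ), ∀ᶠ k in atTop,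
      ∃ x : ℝ, -1 < x ∧ ¬ IsGoodFloor Nf K k x := by
  intro Nf hNf
  obtain ⟨R, p, A, hA, hε⟩ := h Nf hNf
  set R' : ℝ := max R 1 with hR'
  set p' : ℝ := max p 0 with hp'
  have hR'1 : 1 ≤ R' := le_max_right _ _
  have hR'pos : 0 < R' := one_pos.trans_le hR'1
  have hp'0 : 0 ≤ p' := le_max_right _ _
  -- small threshold scales: `0 < K ≤ 1/(8R')`
  have hKev : ∀ᶠ K in 𝓝[>] (0 : ℝ), K ∈ Ioi (0 : ℝ) ∧ K ≤ 1 / (8 * R') := by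
    refine (eventually_mem_nhdsWithin).and ?_
    exact (eventually_le_nhds (by positivity : (0 : ℝ) < 1 / (8 * R'))).filter_mono
      nhdsWithin_le_nhds
  filter_upwards [hKev] with K hKK
  obtain ⟨hK, hKR⟩ := hKK
  have hK' : (0 : ℝ) < K := hK
  have hKR' : R' * K ≤ 1 / 8 := by
    have := (le_div_iff₀ (by positivity : (0 : ℝ) < 8 * R')).1 hKR
    linarith
  have hk := hε (2 * K) (by positivity)
  filter_upwards [hk, eventually_lightRace hK' hR'1 hKR' hp'0 hA Nf] with k hck hrk
  obtain ⟨c, hc, hcS⟩ := hck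
  obtain ⟨hlo, hhi, hrace⟩ := hrk
  refine ⟨c, hc, fun hgood => ?_⟩
  -- the degenerate tuple at `c` is certified by the good floor `c`
  have hcert : Certified Nf K k (fun _ => c) :=
    hgood _ (fun _ => le_rfl) (fun _ _ => by simpa using slabWidth_nonneg Nf k)
  -- the light input at the top shell `n = L_k`, on a torus `S ≥ L_k`
  obtain ⟨S, hS, hnS, f, hfm⟩ := hcS (volSeq K k) (volSeq K k) hlo hhi
  have hfm₀ : A * Real.exp (-(R * (aSeq k * (volSeq K k : ℝ)) +
      p * Real.log ((volSeq K k : ℝ) + 1))) ≤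
      fm Nf (betaSeq Nf k) (fun _ => c) S f (Pi.single 0 ((volSeq K k : ℕ) : ℤ)) (1 / 2) := hfm
  have hfm' : A * Real.exp (-(R' * (aSeq k * (volSeq K k : ℝ)) +
      p' * Real.log ((volSeq K k : ℝ) + 1))) ≤
      fm Nf (betaSeq Nf k) (fun _ => c) S f (Pi.single 0 ((volSeq K k : ℕ) : ℤ)) (1 / 2) := by
    refine le_trans (mul_le_mul_of_nonneg_left (Real.exp_le_exp.2 ?_) hA.le) hfm₀
    have h0 : 0 ≤ aSeq k * (volSeq K k : ℝ) := mul_nonneg (aSeq_pos k).le (Nat.cast_nonneg _)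
    have hl0 : 0 ≤ Real.log ((volSeq K k : ℝ) + 1) :=
      Real.log_nonneg (le_add_of_nonneg_left (Nat.cast_nonneg _))
    have e1 := mul_le_mul_of_nonneg_right (le_max_left R 1) h0
    have e2 := mul_le_mul_of_nonneg_right (le_max_left p 0) hl0
    linarith
  -- the shell bound at `q = k`, `v = L_k e₀`
  have hv : (Pi.single 0 ((volSeq K k : ℕ) : ℤ) : Literature.Probability.LatticeModels.Site 4) ∈
      box 4 S := single_natCast_mem_box hnS
  have hnorm : ‖(Pi.single 0 ((volSeq K k : ℕ) : ℤ) : Literature.Probability.LatticeModels.Site 4)‖ =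
      (shellRadius K k k : ℝ) := norm_single_natCast _
  have hC : (volSeq K k : ℝ) ^ k * (1 + |betaSeq Nf k|) ^ k *
      fm Nf (betaSeq Nf k) (fun _ => c) S f (Pi.single 0 ((volSeq K k : ℕ) : ℤ)) (1 / 2) ≤ 1 :=
    hcert k le_rfl S hS f _ hv hnorm
  have h0 : 0 ≤ (volSeq K k : ℝ) ^ k * (1 + |betaSeq Nf k|) ^ k := by positivity
  have := mul_le_mul_of_nonneg_left hfm' h0
  linarith

/-! #### The planner's `stub_lightPoint` — **INFRARED: A LIGHT POINT EXISTS ABOVE `-1`** (= `RangeRef` of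
`shoot-the-bare-mass`; TRIAGE-r1-2 sharpen (2)). For `N_f ∈ {2,3}` and every sufficiently small
threshold scale `K`, eventually in `k` some bare mass `x > -1` is a BAD floor: some near-degenerate
tuple (spread `≤ w_k`) above `x` has a flavour violating a shell bound, i.e. whose phase-quenched
fractional moment at a log shell on some torus `S ≥ L_k` exceeds `ℓ₀^{-q}(1+|β_k|)^{-q}` — lattice decay
rate below `(1+o(1)) a_k/(4K)`, physical correlation length `≳ 4K/Λ_lat`. By the up-set property this
pins `x ≤ thrMass k`, so the threshold is NOT the lattice-heavy doubler point `-1⁺` (where (iii) would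
fail). Why plausible: light hadrons exist on the Wilson bare axis at weak coupling in EVERY scenario —
continuous chiral line (`m_PS → 0` as `m₀ ↓ m_c(β_k)`), first-order (Sharpe–Singleton `c₂ < 0`: minimal
`m_PS ≍ a_k · a_kΛ² ≪ a_k/(4K)`), Aoki phase (massless pions inside the finger). Why it might fail /
what it costs: it is an existence statement about the INTERACTING lattice theory at `β_k → ∞` with a
quantitative threshold (`ξ ≥ 4K` physical) for the quark-line fractional moment (not an RP-positive
correlator: F2/BN3 of the findings); no free-field or hopping argument reaches the critical region.
Leans on: tree `QuarkMassMonotone.CriticalLineExists` (route decl, unproved), `HJLLocality`. -/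

/-- `lightPoint` (the planner's `stub_lightPoint`, statement verbatim) — now a THEOREM of the registered
tree-vocabulary stub `stub_lightBareMass` (glue `lightPoint_of_lightBareMass`, sorry-free; lead's reshape
cycle 2 after the stub-worker's reduction). -/
theorem lightPoint :
    ∀ Nf : ℕ, Nf = 2 ∨ Nf = 3 → ∀ᶠ K in 𝓝[>] (0 : ℝ), ∀ᶠ k in atTop,
      ∃ x : ℝ, -1 < x ∧ ¬ IsGoodFloor Nf K k x :=
  lightPoint_of_lightBareMass stub_lightBareMass


/-! #### Flavour-permutation covariance of `fm` (sorry-free; tree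
`Literature/MathematicalPhysics/QuantumFieldTheory/QCDFlavourPermutation.lean`, landed p97739 by this line).
It discharges step (ii) of `stub_noJump` (flavour `f'` of the violating tuple ⇒ every flavour `f` of the
window tuple): exchanging `m_f, m_{f'}` and reading flavour `f'` is reading flavour `f`, and the window is
exchange-invariant. -/

/-- **`fm` is flavour-permutation covariant**: the phase-quenched fractional moment of flavour `g` at
the mass tuple with `m_f, m_g` exchanged equals the moment of flavour `f` at `mq` (the weight
`|det D|` is a symmetric function of the masses; the propagator blocks permute — no invertibility
hypothesis; tree `phaseQuenched_propagatorMoment_swap`). -/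
theorem fm_comp_swap (Nf : ℕ) (β : ℝ) (mq : Fin Nf → ℝ) (S : ℕ) (f g : Fin Nf)
    (v : Literature.Probability.LatticeModels.Site 4) (s : ℝ) :
    fm Nf β (mq ∘ Equiv.swap f g) S g v s = fm Nf β mq S f v s :=
  phaseQuenched_propagatorMoment_swap β S mq f g v s

/-! #### The rate form of a violated shell bound (sorry-free) -/

/-- **A violated shell bound is `R₀`-lightness with `R₀ = (1 + K + betaGrowth N_f)/K`**: if
`1 < ℓ₀(q,k)^q (1+|β_k|)^q · F` for some `q ≤ k` (with `1 ≤ ℓ₀(0,k)` and `4(k+2) ≥ 1/K`), then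
`exp(-R₀ · a_k ℓ₀(q,k)) ≤ F` — because `ℓ₀(q,k)^q (1+|β_k|)^q ≤ e^{q(4K + A + 4k + 2)}` while
`R₀ a_k ℓ₀(q,k) ≥ 4(1+K+A)(q+1)(k+2) - (1+K+A)/K`. Pure real analysis (cf. `eventually_shellProduct_le_one`). -/
theorem exp_le_of_shell_violation {K : ℝ} (hK : 0 < K) (Nf : ℕ) {k q : ℕ} (hq : q ≤ k)
    (hk : 1 / (4 * K) ≤ (k : ℝ) + 2) (h1 : 1 ≤ shellRadius K 0 k) {F : ℝ}
    (hF : 1 < (shellRadius K q k : ℝ) ^ q * (1 + |betaSeq Nf k|) ^ q * F) :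
    Real.exp (-((1 + K + betaGrowth Nf) / K * (aSeq k * (shellRadius K q k : ℝ)))) ≤ F := by
  set A : ℝ := betaGrowth Nf with hA
  set X : ℝ := (shellRadius K q k : ℝ) with hX
  set B : ℝ := 1 + |betaSeq Nf k| with hB
  have hA1 : 1 ≤ A := one_le_betaGrowth Nf
  have hX1 : 1 ≤ X := by
    rw [hX]; exact_mod_cast h1.trans (shellRadius_mono hK.le (Nat.zero_le q) k)
  have hB1 : 1 ≤ B := by rw [hB]; exact le_add_of_nonneg_right (abs_nonneg _)
  have hk0 : (0 : ℝ) ≤ k := Nat.cast_nonneg k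
  have hq0 : (0 : ℝ) ≤ q := Nat.cast_nonneg q
  have hqk : (q : ℝ) ≤ k := by exact_mod_cast hq
  -- sizes: `X ≤ exp(4K + 3k + 2)`, `B ≤ exp(A + k)`
  have e1 : 4 * K ≤ Real.exp (4 * K) := by have := Real.add_one_le_exp (4 * K); linarith
  have e2 : (q : ℝ) + 1 ≤ Real.exp (k : ℝ) := by
    have := Real.add_one_le_exp (q : ℝ); linarith [Real.exp_le_exp.2 hqk]
  have e3 : (k : ℝ) + 2 ≤ Real.exp ((k : ℝ) + 1) := by
    have := Real.add_one_le_exp ((k : ℝ) + 1); linarith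
  have h0 : X ≤ (4 * K) * ((q : ℝ) + 1) * ((k : ℝ) + 2) * Real.exp ((k : ℝ) + 1) :=
    calc X ≤ 4 * ((q : ℝ) + 1) * K * ((k : ℝ) + 2) * Real.exp ((k : ℝ) + 1) := shellRadius_le hK.le q k
      _ = (4 * K) * ((q : ℝ) + 1) * ((k : ℝ) + 2) * Real.exp ((k : ℝ) + 1) := by ring
  have hXhi : X ≤ Real.exp (4 * K + 3 * k + 2) :=
    calc X ≤ (4 * K) * ((q : ℝ) + 1) * ((k : ℝ) + 2) * Real.exp ((k : ℝ) + 1) := h0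
      _ ≤ Real.exp (4 * K) * Real.exp (k : ℝ) * Real.exp ((k : ℝ) + 1) * Real.exp ((k : ℝ) + 1) :=
          mul_le_mul_of_nonneg_right
            (mul_le_mul (mul_le_mul e1 e2 (by positivity) (Real.exp_pos _).le) e3 (by positivity)
              (by positivity)) (Real.exp_pos _).le
      _ = Real.exp (4 * K + 3 * k + 2) := by simp only [← Real.exp_add]; ring_nf
  have hBhi : B ≤ Real.exp (A + k) := by
    have hb : B ≤ A * ((k : ℝ) + 1) := one_add_abs_betaSeq_le Nf k
    have f1 : A ≤ Real.exp (A - 1) := by have := Real.add_one_le_exp (A - 1); linarith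
    have f2 : (k : ℝ) + 1 ≤ Real.exp (k : ℝ) := Real.add_one_le_exp _
    calc B ≤ A * ((k : ℝ) + 1) := hb
      _ ≤ Real.exp (A - 1) * Real.exp (k : ℝ) := mul_le_mul f1 f2 (by positivity) (Real.exp_pos _).le
      _ = Real.exp (A - 1 + k) := (Real.exp_add _ _).symm
      _ ≤ Real.exp (A + k) := Real.exp_le_exp.2 (by linarith)
  -- `X^q B^q ≤ exp(q (4K + A + 4k + 2))`
  have hpow : X ^ q * B ^ q ≤ Real.exp ((q : ℝ) * (4 * K + A + 4 * k + 2)) := by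
    have p1 : X ^ q ≤ Real.exp (4 * K + 3 * k + 2) ^ q := pow_le_pow_left₀ (by linarith) hXhi q
    have p2 : B ^ q ≤ Real.exp (A + k) ^ q := pow_le_pow_left₀ (by linarith) hBhi q
    calc X ^ q * B ^ q ≤ Real.exp (4 * K + 3 * k + 2) ^ q * Real.exp (A + k) ^ q :=
          mul_le_mul p1 p2 (by positivity) (by positivity)
      _ = Real.exp ((q : ℝ) * (4 * K + A + 4 * k + 2)) := by
          rw [← Real.exp_nat_mul, ← Real.exp_nat_mul, ← Real.exp_add]; ring_nf
  -- `a_k X ≥ 4(q+1)K(k+2) - 1` (the floor loses at most one lattice unit)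
  have haX : 4 * ((q : ℝ) + 1) * K * ((k : ℝ) + 2) - 1 ≤ aSeq k * X := by
    have ha := aSeq_pos k
    have ha1 := aSeq_le_one k
    have hfl : 4 * ((q : ℝ) + 1) * K * (1 + |Real.log (aSeq k)|) / aSeq k < X + 1 := by
      rw [hX]; unfold shellRadius; exact Nat.lt_floor_add_one _
    rw [abs_log_aSeq, div_lt_iff₀ ha] at hfl
    nlinarith
  -- the exponent budget
  have hRaX : 4 * (1 + K + A) * ((q : ℝ) + 1) * ((k : ℝ) + 2) - (1 + K + A) / K ≤
      (1 + K + A) / K * (aSeq k * X) := by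
    have hCK : 0 ≤ (1 + K + A) / K := by positivity
    have := mul_le_mul_of_nonneg_left haX hCK
    have e : (1 + K + A) / K * (4 * ((q : ℝ) + 1) * K * ((k : ℝ) + 2) - 1) =
        4 * (1 + K + A) * ((q : ℝ) + 1) * ((k : ℝ) + 2) - (1 + K + A) / K := by
      field_simp
    linarith
  have hCK4 : (1 + K + A) / K ≤ 4 * (1 + K + A) * ((k : ℝ) + 2) := by
    have e : (1 + K + A) / K = 4 * (1 + K + A) * (1 / (4 * K)) := by field_simp
    rw [e]; exact mul_le_mul_of_nonneg_left hk (by positivity)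
  have hlin : (q : ℝ) * (4 * K + A + 4 * k + 2) ≤ 4 * (1 + K + A) * (q : ℝ) * ((k : ℝ) + 2) := by
    nlinarith [mul_nonneg (mul_nonneg hq0 hk0) hK.le, mul_nonneg (mul_nonneg hq0 hk0) (by linarith : (0:ℝ) ≤ A),
      mul_nonneg hq0 hK.le, mul_nonneg hq0 (by linarith : (0:ℝ) ≤ A)]
  have hexp : (q : ℝ) * (4 * K + A + 4 * k + 2) ≤ (1 + K + A) / K * (aSeq k * X) := by
    have e : 4 * (1 + K + A) * (q : ℝ) * ((k : ℝ) + 2) + (4 * (1 + K + A) * ((k : ℝ) + 2) - (1 + K + A) / K) =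
        4 * (1 + K + A) * ((q : ℝ) + 1) * ((k : ℝ) + 2) - (1 + K + A) / K := by ring
    linarith
  -- `F > 0` and the conclusion
  have hP : 0 < X ^ q * B ^ q := by positivity
  have hFpos : 0 < F := by
    have hprod : 0 < X ^ q * B ^ q * F := by linarith
    rcases pos_and_pos_or_neg_and_neg_of_mul_pos hprod with h | h
    · exact h.2
    · exact absurd h.1 (not_lt.2 hP.le)
  have hmain : Real.exp (-((1 + K + A) / K * (aSeq k * X))) * (X ^ q * B ^ q) ≤ 1 :=
    calc Real.exp (-((1 + K + A) / K * (aSeq k * X))) * (X ^ q * B ^ q)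
        ≤ Real.exp (-((1 + K + A) / K * (aSeq k * X))) * Real.exp ((q : ℝ) * (4 * K + A + 4 * k + 2)) :=
          mul_le_mul_of_nonneg_left hpow (Real.exp_pos _).le
      _ = Real.exp ((q : ℝ) * (4 * K + A + 4 * k + 2) - (1 + K + A) / K * (aSeq k * X)) := by
          rw [← Real.exp_add]; ring_nf
      _ ≤ 1 := Real.exp_le_one_iff.2 (by linarith)
  calc Real.exp (-((1 + K + A) / K * (aSeq k * X)))
      = Real.exp (-((1 + K + A) / K * (aSeq k * X))) * 1 := (mul_one _).symm
    _ ≤ Real.exp (-((1 + K + A) / K * (aSeq k * X))) * (X ^ q * B ^ q * F) :=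
        mul_le_mul_of_nonneg_left hF.le (Real.exp_pos _).le
    _ = (Real.exp (-((1 + K + A) / K * (aSeq k * X))) * (X ^ q * B ^ q)) * F := by ring
    _ ≤ 1 * F := mul_le_mul_of_nonneg_right hmain hFpos.le
    _ = F := one_mul F

/-- `stub_noJumpKernel` — **THE WINDOW KERNEL (BN2 toll), same flavour, tree currencies only**
(worker's reshape proposal for `stub_noJump`, 2026-08-16): for `N_f ∈ {2,3}`, every sufficiently
small `K`, every `M > 0` and every rate `R₀` there is a rate `R = R(K, M, R₀)` such that eventually
in `k`, for all bare tuples `t, t'` on the physical branch (`t' ≥ -1`, `t > -1`) with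
`t ≤ t' + (M+1)·a_k/Z_m(k)` componentwise (the target is at most `M+1` renormalised units HEAVIER,
valence and sea alike — the one-sided direction), `t' ≤ t + w_k` componentwise (and at most a slab
`w_k = k·a_k/Z_m(k)` lighter), `t` near-degenerate at the window scale and `t'` at the slab scale:
if flavour `f` of `t'` is `R₀`-light at the log scale then flavour `f` of `t` is `R`-light at the log
scale (`ShellLight`: SOME torus `S ≥ L_k`, SOME point between the innermost and the outermost shell).
Content: a ONE-SIDED modulus of continuity of the decay rate of the phase-quenched fractional moment
in the bare masses at resolution `a_k/Z_m(k)`, UNIFORMLY IN THE VOLUME (the light point `(S', v')`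
of `t'` is arbitrary, `S' ≥ L_k` unbounded): (a) valence — one-sided leading-log running of the quark
mass, `liminf_a Z_true(a)/(log a⁻²)^{γ₀/2β₀} < ∞` (BN2; Montvay–Münster (5.84), (5.91)); (b) sea —
the `|det|`-weight responds to a mass shift `δ` with log-derivative `Σ_x Re tr G_g(x,x) = O((2S'+1)⁴)`
(extensive), so configuration-wise / fixed-volume continuity (`fm` is continuous in `t` at FIXED
`S, v` — finite-dimensional integrals of `|det|^{1/2}(Σ|adj|)^{1/2}` — with a volume-dependent modulus)
is useless and the statement is a clustering input for the phase-quenched measure at weak coupling. Why it might fail: first-order jump of the rate across the threshold; volume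
non-uniformity. No tree engine (route decls `QuarkMassMonotone.LatticeGapMonotone`,
`MassDerivativeIdentity` do not imply it: the first is gap monotonicity under a clustering
certificate, the second a finite-volume derivative identity). -/
theorem stub_noJumpKernel :
    ∀ Nf : ℕ, Nf = 2 ∨ Nf = 3 → ∀ᶠ K in 𝓝[>] (0 : ℝ), ∀ M R₀ : ℝ, 0 < M → ∃ R : ℝ, ∀ᶠ k in atTop,
      ∀ t t' : Fin Nf → ℝ, (∀ g, -1 ≤ t' g) → (∀ g, -1 < t g) →
        (∀ g, t g ≤ t' g + aSeq k * (M + 1) / zmSeq Nf k) → (∀ g, t' g ≤ t g + slabWidth Nf k) →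
          (∀ g g', |t g - t g'| ≤ aSeq k * M / zmSeq Nf k) → (∀ g g', |t' g - t' g'| ≤ slabWidth Nf k) →
            ∀ f, ShellLight Nf K k R₀ t' f → ShellLight Nf K k R t f := by
  sorry

/-- **Glue (sorry-free): the window kernel ⇒ the planner's `stub_noJump`.** Free input from
`thrMass = sInf floorSet` (a bad floor just below the threshold ⇒ a violating tuple `t'` ⇒ an `R₀`-light
flavour `f'`, `exp_le_of_shell_violation`); the kernel moves lightness to the window tuple with `f, f'`
exchanged, and `fm_comp_swap` undoes the exchange (stub-worker's reduction, 2026-08-16). -/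
theorem noJump_of_noJumpKernel
    (hker₀ : ∀ Nf : ℕ, Nf = 2 ∨ Nf = 3 → ∀ᶠ K in 𝓝[>] (0 : ℝ), ∀ M R₀ : ℝ, 0 < M → ∃ R : ℝ, ∀ᶠ k in atTop,
      ∀ t t' : Fin Nf → ℝ, (∀ g, -1 ≤ t' g) → (∀ g, -1 < t g) →
        (∀ g, t g ≤ t' g + aSeq k * (M + 1) / zmSeq Nf k) → (∀ g, t' g ≤ t g + slabWidth Nf k) →
          (∀ g g', |t g - t g'| ≤ aSeq k * M / zmSeq Nf k) → (∀ g g', |t' g - t' g'| ≤ slabWidth Nf k) →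
            ∀ f, ShellLight Nf K k R₀ t' f → ShellLight Nf K k R t f) :
    ∀ Nf : ℕ, Nf = 2 ∨ Nf = 3 → ∀ᶠ K in 𝓝[>] (0 : ℝ), ∀ M : ℝ, 0 < M → ∃ R : ℝ, ∀ᶠ k in atTop,
      (floorSet Nf K k).Nonempty → -1 < thrMass Nf K k → ∀ t : Fin Nf → ℝ, (∀ f, thrMass Nf K k < t f) →
        (∀ f, t f ≤ thrMass Nf K k + aSeq k * M / zmSeq Nf k) → ∀ f, ShellLight Nf K k R t f := by
  -- REDUCTION (sorry-free given `stub_noJumpKernel`): free input from `thrMass = sInf floorSet`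
  -- (a bad floor just below the threshold ⇒ a violating tuple `t'` ⇒ `R₀`-light flavour `f'`,
  -- `exp_le_of_shell_violation`), the kernel moves lightness to the window tuple with `f, f'`
  -- exchanged, and `fm_comp_swap` undoes the exchange.
  intro Nf hNf
  have hK₀ : ∀ᶠ K in 𝓝[>] (0 : ℝ), K ∈ Ioi (0 : ℝ) := eventually_mem_nhdsWithin
  filter_upwards [hK₀, hker₀ Nf hNf] with K hK hker M hM
  have hK' : (0 : ℝ) < K := hK
  obtain ⟨R, hR⟩ := hker M ((1 + K + betaGrowth Nf) / K) hM
  refine ⟨R, ?_⟩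
  have hk4 : ∀ᶠ k : ℕ in atTop, 1 / (4 * K) ≤ (k : ℝ) + 2 := by
    filter_upwards [tendsto_natCast_atTop_atTop.eventually_ge_atTop (1 / (4 * K))] with k hk
    linarith
  filter_upwards [hR, hk4, eventually_one_le_shellRadius hK' 0] with k hRk hk h1 hne hθ t ht₁ ht₂ f
  have hδ : 0 < aSeq k / zmSeq Nf k := div_pos (aSeq_pos k) (zmSeq_pos Nf k)
  -- the free input: `u := max (-1) (thrMass - a_k/Z_m)` is a bad floor
  set u : ℝ := max (-1) (thrMass Nf K k - aSeq k / zmSeq Nf k) with hu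
  have hu1 : -1 ≤ u := le_max_left _ _
  have huθ : u < thrMass Nf K k := max_lt hθ (by linarith)
  have hnot : u ∉ floorSet Nf K k := notMem_of_lt_csInf huθ (floorSet_bddBelow Nf K k)
  have hbad : ¬ IsGoodFloor Nf K k u := fun h => hnot ⟨hu1, h⟩
  obtain ⟨t', ht'u, ht'sp, hnc⟩ : ∃ t' : Fin Nf → ℝ, (∀ g, u ≤ t' g) ∧
      (∀ g g', |t' g - t' g'| ≤ slabWidth Nf k) ∧ ¬ Certified Nf K k t' := by
    by_contra h
    push Not at h
    exact hbad fun t' h₁ h₂ => h t' h₁ h₂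
  -- some component of `t'` is `≤ thrMass` (else `t'` would be certified: THE LEVER)
  obtain ⟨g₀, hg₀⟩ : ∃ g₀, t' g₀ ≤ thrMass Nf K k := by
    by_contra h
    push Not at h
    exact hnc (certified_of_thrMass_lt hne h ht'sp)
  -- the violated shell bound, in rate form: flavour `f'` of `t'` is `R₀`-light
  obtain ⟨q, hq, S', hS', f', v', hv', hnorm, hlt⟩ : ∃ q, q ≤ k ∧ ∃ S', volSeq K k ≤ S' ∧
      ∃ (f' : Fin Nf) (v' : Literature.Probability.LatticeModels.Site 4), v' ∈ box 4 S' ∧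
        ‖v'‖ = (shellRadius K q k : ℝ) ∧
          1 < (shellRadius K q k : ℝ) ^ q * (1 + |betaSeq Nf k|) ^ q *
            fm Nf (betaSeq Nf k) t' S' f' v' (1 / 2) := by
    by_contra h
    push Not at h
    exact hnc fun q hq S' hS' f' v' hv' hnorm => h q hq S' hS' f' v' hv' hnorm
  have hSL' : ShellLight Nf K k ((1 + K + betaGrowth Nf) / K) t' f' := by
    refine ⟨S', hS', v', hv', ?_, ?_, ?_⟩
    · rw [hnorm]; exact_mod_cast shellRadius_mono hK'.le (Nat.zero_le q) k
    · rw [hnorm]; exact_mod_cast shellRadius_mono hK'.le hq k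
    · rw [hnorm]; exact exp_le_of_shell_violation hK' Nf hq hk h1 hlt
  -- the window tuple with `f, f'` exchanged is again a window tuple; apply the kernel to it
  have hTw₁ : ∀ g, thrMass Nf K k < (t ∘ Equiv.swap f f') g := fun g => ht₁ _
  have hTw₂ : ∀ g, (t ∘ Equiv.swap f f') g ≤ thrMass Nf K k + aSeq k * M / zmSeq Nf k := fun g => ht₂ _
  have hSLT : ShellLight Nf K k R (t ∘ Equiv.swap f f') f' := by
    refine hRk (t ∘ Equiv.swap f f') t' (fun g => hu1.trans (ht'u g)) (fun g => hθ.trans (hTw₁ g))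
      (fun g => ?_) (fun g => ?_) (fun g g' => ?_) ht'sp f' hSL'
    · have hg : thrMass Nf K k - aSeq k / zmSeq Nf k ≤ t' g := (le_max_right _ _).trans (ht'u g)
      have e : aSeq k * (M + 1) / zmSeq Nf k = aSeq k * M / zmSeq Nf k + aSeq k / zmSeq Nf k := by ring
      rw [e]; linarith [hTw₂ g]
    · have hg : t' g ≤ t' g₀ + slabWidth Nf k := by
        have := ht'sp g g₀; rw [abs_le] at this; linarith [this.2]
      linarith [hTw₁ g]
    · rw [abs_le]; constructor <;> linarith [hTw₁ g, hTw₂ g, hTw₁ g', hTw₂ g']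
  -- undo the exchange
  obtain ⟨S, hS, v, hv, hv₁, hv₂, hfm⟩ := hSLT
  refine ⟨S, hS, v, hv, hv₁, hv₂, ?_⟩
  rwa [fm_comp_swap] at hfm

/-! #### The planner's `stub_noJump` — **THE WINDOW (BN2 toll): LIGHTNESS PERSISTS ACROSS THE RENORMALISED WINDOW**.
For `N_f ∈ {2,3}`, every sufficiently small `K` and every `M > 0` there is a rate `R = R(M,K)` such that
eventually in `k`: if the threshold is a genuine point of the branch (`-1 < thrMass k`, supplied by
`stub_lightPoint`), then EVERY flavour of EVERY bare tuple in the window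
`(thrMass k, thrMass k + a_k M / Z_m(k)]^{N_f}` is `R`-light at the log scale (`ShellLight`). Input the
prover gets for free from the definition of `thrMass` (pure order logic: `not_mem_of_lt_csInf` with
`floorSet_bddBelow`, then the argument of `certified_of_thrMass_lt`): for every `u ∈ [-1, thrMass k)`
some tuple with min component in `[u, thrMass k]` and spread `≤ w_k` violates a shell bound, i.e. has
a flavour of lattice rate `< (1+o(1)) a_k/(4K)` at a shell `ℓ₀(q,k) ∈ [ℓ₀(0,k), L_k]`; and window
tuples themselves are CERTIFIED (`certified_of_thrMass_lt`: rate `≥ (1-o(1)) q/((q+1)4K)` at every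
shell). Design note: the slab `w_k` matters twice — partially-heavy sea profiles (effectively fewer
flavours at the same `β`) would move the light point by `O(g₀⁴) ≫ a_kM/Z_m`, so the certificate only
quantifies near-degenerate tuples; and the up-set quantifier (all tuples ABOVE `u`, not a slab AT `u`)
is what lets the infimum find the HIGHEST light point instead of parking in the lattice-heavy doubler
region just above `-1`. Content = a ONE-SIDED modulus of continuity of the fractional-moment decay
rate in the bare masses at resolution `a_k/Z_m(k)`, uniformly in the volume: (a) VALENCE — raising a
flavour's bare mass by `≤ a_k M/Z_m(k)` raises its physical rate by `≤ C·M·(Z_true/Z_m)`: this is BN2,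
`liminf_a Z_true(a)/(log a⁻²)^{γ₀/2β₀} < ∞`, the one-sided leading-log running of the quark mass that
EVERY line through this crux pays (FindingsRound1Ideator2 BN2 / Ideator3 F3; Montvay–Münster (5.84),
(5.91)); with `K` small the threshold mass `M_thr ≍ Λ_lat/(4K)` is heavy and the running happens at
`g²(μ) ≤ g²(M_thr)`; (b) SEA — the violating tuple and the window tuple have sea masses within
`w_k + a_kM/Z_m` of each other; the induced shift of the light flavour's rate is a two-loop
(`O(g₀⁴ · log(spread))`) effect, and its SIGN is the load-bearing "sea ordering at fixed `β`" (lighter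
Wilson sea ⇒ finer lattice, higher `m_c`, i.e. `κ_c` decreases under unquenching — SESAM/UKQCD/CP-PACS
lore, Hasenfratz–DeGrand `Δβ > 0`), which makes the fully degenerate profile the extremal one so that
`thrMass` IS the degenerate light point. Why it might fail: a first-order jump of the rate across the
threshold at weak coupling (light phase ↔ lattice-heavy phase, hysteresis in `m₀` across `κ_c`); the
opposite sea ordering (then `thrMass` overshoots the degenerate light point by `≫ a_kM/Z_m` and the
realised quarks are physically infinitely heavy); volume-non-uniform continuity in the masses (the
threshold quantifies all `S ≥ L_k`). -/

/-- `noJump` (the planner's `stub_noJump`, statement verbatim) — now a THEOREM of the registered kernel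
`stub_noJumpKernel` (lead's reshape cycle 2 after the stub-worker's reduction). -/
theorem noJump :
    ∀ Nf : ℕ, Nf = 2 ∨ Nf = 3 → ∀ᶠ K in 𝓝[>] (0 : ℝ), ∀ M : ℝ, 0 < M → ∃ R : ℝ, ∀ᶠ k in atTop,
      (floorSet Nf K k).Nonempty → -1 < thrMass Nf K k → ∀ t : Fin Nf → ℝ, (∀ f, thrMass Nf K k < t f) →
        (∀ f, t f ≤ thrMass Nf K k + aSeq k * M / zmSeq Nf k) → ∀ f, ShellLight Nf K k R t f :=
  noJump_of_noJumpKernel stub_noJumpKernel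


/-! #### The planner's `stub_transport` — **TRANSPORT OF LOWER BOUNDS: one light shell point ⇒ the all-distance,
all-volume lower pin (iii)** (TRIAGE-r1-2 sharpen (3) / r1-3: "lower bounds do not transport by
Hölder" — named as its own stub). For `N_f ∈ {2,3}`, every sufficiently small `K`, every `M > 0` and
rate `R` there are `s ∈ (0,1)`, `c₀ > 0`, `C₁`, `p` such that eventually in `k`, for every bare tuple
`t` in the window above the threshold all of whose flavours are `R`-light at the log scale:
`c₀ e^{-C₁ a_k n}(n+1)^{-p} ≤ E_{|w|,k,S}[(Σ|G_f(0,ne₀)|)^s]` for ALL `S ≥ L_k`, all flavours, all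
`n ≤ S` — verbatim the matrix of clause (iii). Free side information: window tuples are certified
(`certified_of_thrMass_lt`), so every flavour ALSO has rate `≥ (1-o(1))/(4K)·q/(q+1)` at every shell —
two-sided control at the log scales `a_k n ∈ [4K(k+2), 4K(k+1)(k+2)]`, deep inside the asymptotic
regime (`≫` the correlation length `4K`). Content: (T1) `n ≲ ℓ₀(0,k)` (UV window down to `n = 0`):
`k`-uniform lower bounds `≳ (n+1)^{-p}` — short-distance near-free behaviour of the interacting
propagator moment (no `β`-room: `c₀` is fixed before `k` while `β_k → ∞`, Disproof `tendsto_beta_atTop`;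
TRIAGE-r1-2 B3); (T2) `n ≥ L_k`, `S → ∞`: the rate measured at one log-shell point in ONE volume is
the asymptotic rate in EVERY larger volume (single-state dominance / volume-independence of the
phase-quenched state); (T3) shell point `v` (sup-norm) ⇒ axis point. Why it might fail:
`E_{|w|}[|G|^s]`, `s < 1`, is not a reflection-positive two-point function (F2: the mean pion
correlator is infinite for split tuples), so no spectral representation / log-convexity in `n` is
available, and `|Σ|^s` has no super-multiplicative splitting; volume-uniformity of a LOWER bound is a
clustering (uniqueness-of-phase) input for the `|Π det|`-weighted measure. -/

/-- `stub_lowerPin` — **LOWER PIN FROM ONE LIGHT SHELL POINT** (lead's reshape cycle 2 of the planner's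
`stub_transport`, after the stub-worker's reduction; its whole open content, in the line's currencies with
`M`, `thrMass` and the window REMOVED — what the skeleton supplies for free about window tuples is kept as
hypotheses: `-1 < t_f` (`neg_one_le_thrMass`), the certificate (`certified_of_thrMass_lt`: every shell bound
`q ≤ k` on every torus `S ≥ L_k`, exponent `½`) and one light shell point per flavour (`ShellLight`)). For
`N_f ∈ {2,3}`, every sufficiently small `K` and every rate `R` there are `s ∈ (0,1)`, `c₀ > 0`, `C₁`, `p`
such that eventually in `k` every bare tuple `t > -1` that is CERTIFIED and everywhere `R`-LIGHT at the log
scale obeys the lower pin `c₀ e^{-C₁ a_k n}(n+1)^{-p} ≤ fm(t, S, f, n e₀, s)` for all `S ≥ L_k`, all flavours,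
all `n ≤ S` — verbatim the matrix of clause (iii). OPEN lattice-QCD input; three gaps (worker's diagnosis,
numbers): (T1) `k`-uniform UV pin at `n = O(1)` down to `n = 0` at bare masses `≤ 0` with no `β`-room — the tree
has the `n = 0` pin only at positive mass (`QCDPropagatorDiagonalLowerBound`, p87041) and, at every mass, only
the STAR form `12^s ≤ |t_f+4|^s fm(0) + Σ_{±μ} fm(±μ̂)` (`QCDPropagatorNeighbourhoodLowerBound`, p98722: the nine
star moments cannot all be small, none is pinned); (T2) one volume / one shell point ⇒ every volume and every
axis distance — no reflection positivity for the `|det|`-weighted fractional moment (`E_{|w|}‖G‖²` is infinite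
for split tuples), `|Σ|^s` is not super-multiplicative, and even granting log-convexity a light point at
`‖v*‖ = L_k` certifies only `e^{-4RK(k+1)(k+2)}` (quadratic in `k`) where the pin at `n = ℓ₀(0,k)` is linear in
`k` — values transport inward, rates do not: the statement is a single-state/rate statement in full;
(T3) sup-norm shell point ⇒ axis point. `s` is not forced to `½` (Jensen upgrades `ShellLight` to exponents
`s ∈ [½,1)`, tree `qcdPhaseQuenchedExpect_rpow_le_rpow`). Tree-vocabulary twin: `LowerPinOfShellLight` (§8,
`lowerPinOfShellLight_iff`). -/
theorem stub_lowerPin :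
    ∀ Nf : ℕ, Nf = 2 ∨ Nf = 3 → ∀ᶠ K in 𝓝[>] (0 : ℝ), ∀ R : ℝ, ∃ s c₀ C₁ p : ℝ, 0 < s ∧ s < 1 ∧ 0 < c₀ ∧
      ∀ᶠ k in atTop, ∀ t : Fin Nf → ℝ, (∀ f, -1 < t f) → Certified Nf K k t →
        (∀ f, ShellLight Nf K k R t f) →
          ∀ S : ℕ, volSeq K k ≤ S → ∀ (f : Fin Nf) (n : ℕ), n ≤ S →
            c₀ * Real.exp (-(C₁ * (aSeq k * n) + p * Real.log (n + 1))) ≤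
              fm Nf (betaSeq Nf k) t S f (Pi.single 0 (n : ℤ)) s := by
  sorry

/-- **Glue (sorry-free): `stub_lowerPin` ⇒ the planner's `stub_transport`.** Window tuples are `> -1`
(`neg_one_le_thrMass`), have spread `≤ a_k M/Z_m(k) ≤ w_k` for `k ≥ M`, hence are certified
(`certified_of_thrMass_lt`); the light points are the hypothesis (stub-worker's reduction, 2026-08-16). -/
theorem transport_of_lowerPin
    (h : ∀ Nf : ℕ, Nf = 2 ∨ Nf = 3 → ∀ᶠ K in 𝓝[>] (0 : ℝ), ∀ R : ℝ, ∃ s c₀ C₁ p : ℝ, 0 < s ∧ s < 1 ∧ 0 < c₀ ∧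
      ∀ᶠ k in atTop, ∀ t : Fin Nf → ℝ, (∀ f, -1 < t f) → Certified Nf K k t →
        (∀ f, ShellLight Nf K k R t f) →
          ∀ S : ℕ, volSeq K k ≤ S → ∀ (f : Fin Nf) (n : ℕ), n ≤ S →
            c₀ * Real.exp (-(C₁ * (aSeq k * n) + p * Real.log (n + 1))) ≤
              fm Nf (betaSeq Nf k) t S f (Pi.single 0 (n : ℤ)) s) :
    ∀ Nf : ℕ, Nf = 2 ∨ Nf = 3 → ∀ᶠ K in 𝓝[>] (0 : ℝ), ∀ M R : ℝ, 0 < M →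
      ∃ s c₀ C₁ p : ℝ, 0 < s ∧ s < 1 ∧ 0 < c₀ ∧ ∀ᶠ k in atTop, (floorSet Nf K k).Nonempty → ∀ t : Fin Nf → ℝ,
        (∀ f, thrMass Nf K k < t f) → (∀ f, t f ≤ thrMass Nf K k + aSeq k * M / zmSeq Nf k) →
          (∀ f, ShellLight Nf K k R t f) →
            ∀ S : ℕ, volSeq K k ≤ S → ∀ (f : Fin Nf) (n : ℕ), n ≤ S →
              c₀ * Real.exp (-(C₁ * (aSeq k * n) + p * Real.log (n + 1))) ≤
                fm Nf (betaSeq Nf k) t S f (Pi.single 0 (n : ℤ)) s := by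
  intro Nf hNf
  filter_upwards [h Nf hNf] with K hPin M R hM
  obtain ⟨s, c₀, C₁, p, hs, hs₁, hc₀, hk⟩ := hPin R
  refine ⟨s, c₀, C₁, p, hs, hs₁, hc₀, ?_⟩
  filter_upwards [hk, tendsto_natCast_atTop_atTop.eventually_ge_atTop M] with k hk hkM hne t ht₁ ht₂
    hlight S hS f n hn
  -- window tuples are `> -1`
  have hm₁ : ∀ g, -1 < t g := fun g => (neg_one_le_thrMass hne).trans_lt (ht₁ g)
  -- window tuples have spread `≤ w_k`, hence are certified
  have hw : aSeq k * M / zmSeq Nf k ≤ slabWidth Nf k := by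
    unfold slabWidth
    rw [mul_comm (k : ℝ) (aSeq k)]
    exact div_le_div_of_nonneg_right (mul_le_mul_of_nonneg_left hkM (aSeq_pos k).le)
      (zmSeq_pos Nf k).le
  have hsp : ∀ g g', |t g - t g'| ≤ slabWidth Nf k := fun g g' => by
    rw [abs_sub_le_iff]
    constructor <;> linarith [ht₁ g, ht₁ g', ht₂ g, ht₂ g']
  have hcert : Certified Nf K k t := certified_of_thrMass_lt hne ht₁ hsp
  exact hk t hm₁ hcert hlight S hS f n hn

/-- `transport` (the planner's `stub_transport`, statement verbatim) — now a THEOREM of the registered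
stub `stub_lowerPin` (lead's reshape cycle 2 after the stub-worker's reduction). -/
theorem transport :
    ∀ Nf : ℕ, Nf = 2 ∨ Nf = 3 → ∀ᶠ K in 𝓝[>] (0 : ℝ), ∀ M R : ℝ, 0 < M →
      ∃ s c₀ C₁ p : ℝ, 0 < s ∧ s < 1 ∧ 0 < c₀ ∧ ∀ᶠ k in atTop, (floorSet Nf K k).Nonempty → ∀ t : Fin Nf → ℝ,
        (∀ f, thrMass Nf K k < t f) → (∀ f, t f ≤ thrMass Nf K k + aSeq k * M / zmSeq Nf k) →
          (∀ f, ShellLight Nf K k R t f) →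
            ∀ S : ℕ, volSeq K k ≤ S → ∀ (f : Fin Nf) (n : ℕ), n ≤ S →
              c₀ * Real.exp (-(C₁ * (aSeq k * n) + p * Real.log (n + 1))) ≤
                fm Nf (betaSeq Nf k) t S f (Pi.single 0 (n : ℤ)) s :=
  transport_of_lowerPin stub_lowerPin


/-! #### The planner's `stub_sign` — **SIGN DILUTION ON A POLYLOG VOLUME: clause (iv) for the threshold witness**
(the crux's acknowledged open input, localised). For `N_f ∈ {2,3}`, every sufficiently small `K` and
every `M > 0`, eventually in `k`: if `-1 < thrMass k` then for every bare tuple `t` in the window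
`(thrMass k, thrMass k + a_kM/Z_m(k)]^{N_f}`, `½ ≤ |∫ det D(t) dμ_{β_k}| / ∫ |det D(t)| dμ_{β_k}` on the
torus of side `2L_k+1`, i.e. `⟨sign⟩_{|w|} ≥ ½`. By `WilsonDeterminantSign_holds` /
`IsGammaHermitian.exists_zero_between_of_det_mul_neg` the sign of `det D_W(t_f)` is the parity of the
real eigenvalues of `D_W(U;0)` below `-t_f`; window masses sit `≥ a_k M_thr/Z_m` ABOVE the light point,
so a defect needs a real Wilson eigenvalue BELOW the critical smear (dislocations; smooth instantons
of any size are sign-safe, F4), and the clause asks their density per lattice site to be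
`o(a_k⁴ / (8K(k+1)(k+2))⁴)` — a rate-free `o(a⁴/polylog)`, against the semiclassical `a_k^{4b₀S_disl}`.
Small `K` (heavy threshold, all realised quarks `≥ M_thr`) deepens every sign window. Why it might
fail: `4b₀ S_disl ≤ 4` for the Wilson plaquette action (Pugh–Teper dislocations) would leave a
non-vanishing defect density per physical volume; for `N_f = 3` / split masses no positivity rescues
it (barriers WilsonDeterminantSign / WilsonDeterminantMassSplitting are MET here, not evaded); measured
defect frequencies fall `2% → 0.05%` for `a = 0.085 → 0.05 fm` (MohlerSchaefer2020 §4.2) — consistent,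
not a proof.

LEAD'S RESHAPE (cycle 2): the planner's statement is SPLIT by the sign of the bare tuple into the two
registered stubs below. -/

/-! `stub_signPos` — **CLAUSE (iv) AT POSITIVE BARE MASSES** (tree vocabulary; the certified half of the
planner's `stub_sign`; lead's reshape cycle 2): LANDED as
`Summits/QuantumFields/QCD/Theorems/PauliWegnerSeaOneScaleTrajectoryStubSignPos.lean` (p96145, accepted
2026-08-16, commit 87e1c308b6df) and IMPORTED above — the registered theorem
`Summit.QuantumFields.QCD.Cruxes.OneScaleTrajectory.ThresholdTunedWitness.stub_signPos` is used below by name.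
Statement: for every `N_f`, coupling `β`, torus half-side `S` and bare tuple `t` with all components `> 0`,
`½ ≤ ‖∫ det (diracMatrix U t) dμ_β‖ / ∫ ‖det (diracMatrix U t)‖ dμ_β` — indeed the ratio is `1`:
`det (diracMatrix U t) = ∏_f det D_W(U, t_f, 1) > 0` for EVERY `SU(3)` field by Seiler's positivity domain
(`κ < 1/8`; tree `fermionDet_wilsonDirac_re_pos`). Physically idle for the line (the window is expected below
`0`), but it certifies that clause (iv) can only fail through a NON-POSITIVE bare mass. -/

/-- `stub_signNonpos` — **SIGN DILUTION ON A POLYLOG VOLUME, SUPERCRITICAL SIDE** (the open half of the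
planner's `stub_sign`, its statement VERBATIM plus the hypothesis that some component of the window tuple is
`≤ 0`). For `N_f ∈ {2,3}`, every sufficiently small `K` and every `M > 0`, eventually in `k`: if
`-1 < thrMass k` then for every bare tuple `t` in the window `(thrMass k, thrMass k + a_kM/Z_m(k)]^{N_f}` with
SOME `t_f ≤ 0` (so `thrMass k < 0`: the threshold sits on the supercritical side of the Wilson axis, as the
physics of the line expects — `m_c(β_k) ≍ -g₀² < 0` while the window scale is `a_k/Z_m(k)`),
`½ ≤ ‖∫ det D(t) dμ_{β_k}‖ / ∫ ‖det D(t)‖ dμ_{β_k}` on the torus of side `2L_k+1`. Content and risks: as in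
the planner's module docstring above — parity of the real Wilson eigenvalues below `-t_f`, i.e.
the density of sign-active dislocations per lattice site must be `o((2L_k+1)^{-4})` on the polylog physical
volume; for `N_f = 3` and for split `N_f = 2` tuples no positivity rescues it (barriers
WilsonDeterminantSign / WilsonDeterminantMassSplitting are MET here). Leans on: nothing in the tree
(open lattice-QCD input); `IsGammaHermitian.exists_zero_between_of_det_mul_neg` only translates it. -/
theorem stub_signNonpos :
    ∀ Nf : ℕ, Nf = 2 ∨ Nf = 3 → ∀ᶠ K in 𝓝[>] (0 : ℝ), ∀ M : ℝ, 0 < M → ∀ᶠ k in atTop,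
      (floorSet Nf K k).Nonempty → -1 < thrMass Nf K k → ∀ t : Fin Nf → ℝ, (∀ f, thrMass Nf K k < t f) →
        (∀ f, t f ≤ thrMass Nf K k + aSeq k * M / zmSeq Nf k) → (∃ f, t f ≤ 0) →
          (1 / 2 : ℝ) ≤
            ‖∫ U : GaugeConfig 4 (2 * volSeq K k + 1) (Matrix.specialUnitaryGroup (Fin 3) ℂ),
                (diracMatrix U t).det ∂(wilsonMeasure (fundamentalRep (Fin 3)) (betaSeq Nf k))‖ /
              (∫ U : GaugeConfig 4 (2 * volSeq K k + 1) (Matrix.specialUnitaryGroup (Fin 3) ℂ),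
                ‖(diracMatrix U t).det‖ ∂(wilsonMeasure (fundamentalRep (Fin 3)) (betaSeq Nf k))) := by
  sorry

/-! ### §7 The kernel-checked composition -/

/-- **Composition** (sorry-free, standard axioms): the six stub STATEMENTS imply the unfolded crux.
Choose `K > 0` in the intersection of the four `K`-filters; take `reg := thrReg N_f K`; mass scaling
and asymptotic scaling are identities; for `m > 0`: (i) from `-1 ≤ thrMass` (anchor ⇒ floor set
non-empty) and `a_k m_f/Z_m > 0`; (one-scale) with `K₀ := 4(q+1)K`, `s := ½`, `ℓ₀ := ℓ₀(q,k)` — the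
realised tuple lies strictly above the threshold with spread `≤ w_k` eventually, hence is CERTIFIED
(`certified_of_thrMass_lt`), and `1 ≤ ℓ₀ ≤ L_k`, `ℓ₀a_k ≤ K₀(1+|log a_k|)` are §3; (iii) from
`stub_lightPoint` (⇒ `-1 < thrMass`), `stub_noJump` at `M := Σ_f m_f + 1` and `stub_transport`;
(iv) by cases on the realised tuple: all components `> 0` ⇒ `stub_signPos` (Seiler positivity, a
theorem), some component `≤ 0` ⇒ `stub_signNonpos`. -/
theorem composition
    (h₀ : ∀ (Nf : ℕ) (K : ℝ), 0 < K → ∀ m₀ : ℝ, 0 < m₀ → ∀ᶠ k in atTop, m₀ ∈ floorSet Nf K k)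
    (h₁ : ∀ Nf : ℕ, Nf = 2 ∨ Nf = 3 → ∀ᶠ K in 𝓝[>] (0 : ℝ), ∀ᶠ k in atTop,
      ∃ x : ℝ, -1 < x ∧ ¬ IsGoodFloor Nf K k x)
    (h₂ : ∀ Nf : ℕ, Nf = 2 ∨ Nf = 3 → ∀ᶠ K in 𝓝[>] (0 : ℝ), ∀ M : ℝ, 0 < M → ∃ R : ℝ, ∀ᶠ k in atTop,
      (floorSet Nf K k).Nonempty → -1 < thrMass Nf K k → ∀ t : Fin Nf → ℝ, (∀ f, thrMass Nf K k < t f) →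
        (∀ f, t f ≤ thrMass Nf K k + aSeq k * M / zmSeq Nf k) → ∀ f, ShellLight Nf K k R t f)
    (h₃ : ∀ Nf : ℕ, Nf = 2 ∨ Nf = 3 → ∀ᶠ K in 𝓝[>] (0 : ℝ), ∀ M R : ℝ, 0 < M →
      ∃ s c₀ C₁ p : ℝ, 0 < s ∧ s < 1 ∧ 0 < c₀ ∧ ∀ᶠ k in atTop, (floorSet Nf K k).Nonempty → ∀ t : Fin Nf → ℝ,
        (∀ f, thrMass Nf K k < t f) → (∀ f, t f ≤ thrMass Nf K k + aSeq k * M / zmSeq Nf k) →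
          (∀ f, ShellLight Nf K k R t f) →
            ∀ S : ℕ, volSeq K k ≤ S → ∀ (f : Fin Nf) (n : ℕ), n ≤ S →
              c₀ * Real.exp (-(C₁ * (aSeq k * n) + p * Real.log (n + 1))) ≤
                fm Nf (betaSeq Nf k) t S f (Pi.single 0 (n : ℤ)) s)
    (h₄ : ∀ (Nf : ℕ) (β : ℝ) (S : ℕ) (t : Fin Nf → ℝ), (∀ f, 0 < t f) →
      (1 / 2 : ℝ) ≤
        ‖∫ U : GaugeConfig 4 (2 * S + 1) (Matrix.specialUnitaryGroup (Fin 3) ℂ),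
            (diracMatrix U t).det ∂(wilsonMeasure (fundamentalRep (Fin 3)) β)‖ /
          (∫ U : GaugeConfig 4 (2 * S + 1) (Matrix.specialUnitaryGroup (Fin 3) ℂ),
            ‖(diracMatrix U t).det‖ ∂(wilsonMeasure (fundamentalRep (Fin 3)) β)))
    (h₅ : ∀ Nf : ℕ, Nf = 2 ∨ Nf = 3 → ∀ᶠ K in 𝓝[>] (0 : ℝ), ∀ M : ℝ, 0 < M → ∀ᶠ k in atTop,
      (floorSet Nf K k).Nonempty → -1 < thrMass Nf K k → ∀ t : Fin Nf → ℝ, (∀ f, thrMass Nf K k < t f) →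
        (∀ f, t f ≤ thrMass Nf K k + aSeq k * M / zmSeq Nf k) → (∃ f, t f ≤ 0) →
          (1 / 2 : ℝ) ≤
            ‖∫ U : GaugeConfig 4 (2 * volSeq K k + 1) (Matrix.specialUnitaryGroup (Fin 3) ℂ),
                (diracMatrix U t).det ∂(wilsonMeasure (fundamentalRep (Fin 3)) (betaSeq Nf k))‖ /
              (∫ U : GaugeConfig 4 (2 * volSeq K k + 1) (Matrix.specialUnitaryGroup (Fin 3) ℂ),
                ‖(diracMatrix U t).det‖ ∂(wilsonMeasure (fundamentalRep (Fin 3)) (betaSeq Nf k)))) :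
    ∀ Nf : ℕ, Nf = 2 ∨ Nf = 3 → ∃ reg : QCDRegularisation Nf, Clauses Nf reg := by
  intro Nf hNf
  -- choose the threshold scale `K`
  have hK₀ : ∀ᶠ K in 𝓝[>] (0 : ℝ), K ∈ Ioi (0 : ℝ) := eventually_mem_nhdsWithin
  obtain ⟨K, hK, hLP, hNJ, hTR, hSG⟩ :=
    (hK₀.and ((h₁ Nf hNf).and ((h₂ Nf hNf).and ((h₃ Nf hNf).and (h₅ Nf hNf))))).exists
  have hK' : (0 : ℝ) < K := hK
  -- the anchor: the floor set is non-empty eventually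
  have hne : ∀ᶠ k in atTop, (floorSet Nf K k).Nonempty := by
    filter_upwards [h₀ Nf K hK' 1 one_pos] with k hk using ⟨1, hk⟩
  -- the threshold is a genuine point of the branch eventually
  have hthr : ∀ᶠ k in atTop, -1 < thrMass Nf K k := by
    filter_upwards [hne, hLP] with k hk ⟨x, hx, hxg⟩
    exact hx.trans_le (le_thrMass_of_not_isGoodFloor hk hxg)
  refine ⟨thrReg Nf K hK', thrReg_hasMassScaling Nf K hK', thrReg_hasAsymptoticScaling Nf K hK',
    fun m hm => ?_⟩
  -- the realised bare trajectory and its window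
  set M : ℝ := (∑ f, m f) + 1 with hMdef
  have hMpos : 0 < M := by
    have : 0 ≤ ∑ f, m f := Finset.sum_nonneg fun f _ => (hm f).le
    linarith
  have hmM : ∀ f, m f ≤ M := fun f =>
    (Finset.single_le_sum (fun g _ => (hm g).le) (Finset.mem_univ f)).trans (le_add_of_nonneg_right zero_le_one)
  have hwin₁ : ∀ k f, thrMass Nf K k < thrMass Nf K k + aSeq k * m f / zmSeq Nf k := fun k f =>
    lt_add_of_pos_right _ (div_pos (mul_pos (aSeq_pos k) (hm f)) (zmSeq_pos Nf k))
  have hwin₂ : ∀ k f, thrMass Nf K k + aSeq k * m f / zmSeq Nf k ≤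
      thrMass Nf K k + aSeq k * M / zmSeq Nf k := fun k f => by
    have := div_le_div_of_nonneg_right (mul_le_mul_of_nonneg_left (hmM f) (aSeq_pos k).le)
      (zmSeq_pos Nf k).le
    linarith
  -- the spread of the realised tuple is within the slab eventually
  have hB : ∀ f g, |m f - m g| ≤ M := fun f g => by
    rw [abs_sub_le_iff]
    constructor <;> linarith [hmM f, hmM g, hm f, hm g]
  have hspread : ∀ᶠ k in atTop, ∀ f g,
      |(thrMass Nf K k + aSeq k * m f / zmSeq Nf k) - (thrMass Nf K k + aSeq k * m g / zmSeq Nf k)| ≤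
        slabWidth Nf k := by
    filter_upwards [tendsto_natCast_atTop_atTop.eventually_ge_atTop M] with k hk f g
    have ha := aSeq_pos k
    have hz := zmSeq_pos Nf k
    have hq : 0 < aSeq k / zmSeq Nf k := div_pos ha hz
    have : (thrMass Nf K k + aSeq k * m f / zmSeq Nf k) - (thrMass Nf K k + aSeq k * m g / zmSeq Nf k)
        = aSeq k / zmSeq Nf k * (m f - m g) := by ring
    rw [this, abs_mul, abs_of_pos hq]
    calc aSeq k / zmSeq Nf k * |m f - m g| ≤ aSeq k / zmSeq Nf k * (k : ℝ) :=
          mul_le_mul_of_nonneg_left ((hB f g).trans hk) hq.le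
      _ = slabWidth Nf k := by unfold slabWidth; ring
  -- the realised tuple is certified eventually (THE LEVER)
  have hcert : ∀ᶠ k in atTop,
      Certified Nf K k (fun fl => thrMass Nf K k + aSeq k * m fl / zmSeq Nf k) := by
    filter_upwards [hne, hspread] with k hk hsp
    exact certified_of_thrMass_lt hk (fun f => hwin₁ k f) hsp
  refine ⟨?_, ?_, ?_, ?_⟩
  · -- clause (i)
    intro f
    filter_upwards [hne] with k hk
    show -1 < thrMass Nf K k + aSeq k * m f / zmSeq Nf k
    have h1 := neg_one_le_thrMass hk
    have h2 : 0 < aSeq k * m f / zmSeq Nf k := div_pos (mul_pos (aSeq_pos k) (hm f)) (zmSeq_pos Nf k)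
    linarith
  · -- the one-scale clause
    intro q
    refine ⟨4 * ((q : ℝ) + 1) * K, 1 / 2, by norm_num, by norm_num, ?_⟩
    filter_upwards [hcert, eventually_ge_atTop q, eventually_one_le_shellRadius hK' q] with k hck hqk hℓ
    refine ⟨shellRadius K q k, hℓ, shellRadius_mono hK'.le hqk k, shellRadius_mul_aSeq_le hK'.le q k,
      fun S hS f v hv hnorm => ?_⟩
    exact hck q hqk S hS f v hv hnorm
  · -- clause (iii)
    obtain ⟨R, hR⟩ := hNJ M hMpos
    obtain ⟨s, c₀, C₁, p, hs, hs1, hc₀, hT⟩ := hTR M R hMpos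
    refine ⟨s, c₀, C₁, p, hs, hs1, hc₀, ?_⟩
    filter_upwards [hne, hthr, hR, hT] with k hk₀ hk hRk hTk S hS f n hn
    exact hTk hk₀ _ (fun f => hwin₁ k f) (fun f => hwin₂ k f)
      (hRk hk₀ hk _ (fun f => hwin₁ k f) (fun f => hwin₂ k f)) S hS f n hn
  · -- clause (iv): case split on the sign of the realised bare tuple
    filter_upwards [hne, hthr, hSG M hMpos] with k hk₀ hk hSk
    by_cases hpos : ∀ f, 0 < thrMass Nf K k + aSeq k * m f / zmSeq Nf k
    · exact h₄ Nf (betaSeq Nf k) (volSeq K k) _ hpos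
    · obtain ⟨f, hf⟩ := not_forall.mp hpos
      exact hSk hk₀ hk _ (fun f => hwin₁ k f) (fun f => hwin₂ k f) ⟨f, not_lt.mp hf⟩

/-- **The skeleton theorem**: the crux BY NAME from `anchor` (⇐ the registered tree-vocabulary stub
`stub_heavyDecay`), the registered tree-vocabulary stub `stub_signPos` and the four registered physics stubs
(its only non-whitelisted axiom is the `sorryAx` of the open stubs; `composition` and the anchor glue are the
sorry-free logic). -/
theorem OneScaleTrajectory_of : Summit.QuantumFields.QCD.Theses.PauliWegnerSea.OneScaleTrajectory :=
  oneScaleTrajectory_iff.2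
    (composition anchor lightPoint noJump transport stub_signPos stub_signNonpos)


/-! ### §8 Tree-vocabulary twins of the open stubs (for filing as named open inputs / `@[conjecture]` items) -/

/-- **Tree-vocabulary twin of `stub_noJumpKernel`** (stub-worker's appendix, 2026-08-16) — the window kernel in TREE
vocabulary (no line-local definition: `a_k = e^{-(k+1)}`, `β_k = afBeta N_f 1 a_k`,
`Z_m(k) = (log a_k⁻²)^{massExponent N_f}`, `ℓ₀(q,k) = ⌊4(q+1)K(1+|log a_k|)/a_k⌋₊`, `L_k = ℓ₀(k,k)`,
`w_k = k a_k/Z_m(k)` inlined), ready to be filed as a named open input / `@[conjecture]` item;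
`noJumpKernelTree_iff` certifies it is LITERALLY the registered kernel. -/
def NoJumpKernelTree : Prop :=
  ∀ Nf : ℕ, Nf = 2 ∨ Nf = 3 → ∀ᶠ K in 𝓝[>] (0 : ℝ), ∀ M R₀ : ℝ, 0 < M → ∃ R : ℝ, ∀ᶠ k : ℕ in atTop,
    ∀ t t' : Fin Nf → ℝ,
      (∀ g, -1 ≤ t' g) → (∀ g, -1 < t g) →
      (∀ g, t g ≤ t' g + Real.exp (-((k : ℝ) + 1)) * (M + 1) /
          Real.log (1 / Real.exp (-((k : ℝ) + 1)) ^ 2) ^ massExponent Nf) →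
      (∀ g, t' g ≤ t g + (k : ℝ) * Real.exp (-((k : ℝ) + 1)) /
          Real.log (1 / Real.exp (-((k : ℝ) + 1)) ^ 2) ^ massExponent Nf) →
      (∀ g g', |t g - t g'| ≤ Real.exp (-((k : ℝ) + 1)) * M /
          Real.log (1 / Real.exp (-((k : ℝ) + 1)) ^ 2) ^ massExponent Nf) →
      (∀ g g', |t' g - t' g'| ≤ (k : ℝ) * Real.exp (-((k : ℝ) + 1)) /
          Real.log (1 / Real.exp (-((k : ℝ) + 1)) ^ 2) ^ massExponent Nf) →
      ∀ f : Fin Nf,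
        -- flavour `f` of `t'` is `R₀`-light at the log scale …
        (∃ S : ℕ, ⌊4 * ((k : ℝ) + 1) * K * (1 + |Real.log (Real.exp (-((k : ℝ) + 1)))|) /
              Real.exp (-((k : ℝ) + 1))⌋₊ ≤ S ∧
          ∃ v : Literature.Probability.LatticeModels.Site 4, v ∈ box 4 S ∧
            ((⌊4 * (((0 : ℕ) : ℝ) + 1) * K * (1 + |Real.log (Real.exp (-((k : ℝ) + 1)))|) /
                Real.exp (-((k : ℝ) + 1))⌋₊ : ℕ) : ℝ) ≤ ‖v‖ ∧
            ‖v‖ ≤ ((⌊4 * ((k : ℝ) + 1) * K * (1 + |Real.log (Real.exp (-((k : ℝ) + 1)))|) /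
                Real.exp (-((k : ℝ) + 1))⌋₊ : ℕ) : ℝ) ∧
            Real.exp (-(R₀ * (Real.exp (-((k : ℝ) + 1)) * ‖v‖))) ≤
              (∫ U : GaugeConfig 4 (2 * S + 1) (Matrix.specialUnitaryGroup (Fin 3) ℂ),
                  ‖(diracMatrix U t').det‖ *
                    (∑ a : Fin 3, ∑ i : Fin 4, ∑ b : Fin 3, ∑ j : Fin 4,
                      ‖(diracMatrix U t')⁻¹ (quarkEquiv (f, (Torus.proj (2 * S + 1) 0, a, i)))
                        (quarkEquiv (f, (Torus.proj (2 * S + 1) v, b, j)))‖) ^ (1 / 2 : ℝ)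
                  ∂(wilsonMeasure (fundamentalRep (Fin 3)) (afBeta Nf 1 (Real.exp (-((k : ℝ) + 1)))))) /
                (∫ U : GaugeConfig 4 (2 * S + 1) (Matrix.specialUnitaryGroup (Fin 3) ℂ),
                  ‖(diracMatrix U t').det‖
                  ∂(wilsonMeasure (fundamentalRep (Fin 3)) (afBeta Nf 1 (Real.exp (-((k : ℝ) + 1))))))) →
        -- … then flavour `f` of `t` is `R`-light at the log scale
        (∃ S : ℕ, ⌊4 * ((k : ℝ) + 1) * K * (1 + |Real.log (Real.exp (-((k : ℝ) + 1)))|) /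
              Real.exp (-((k : ℝ) + 1))⌋₊ ≤ S ∧
          ∃ v : Literature.Probability.LatticeModels.Site 4, v ∈ box 4 S ∧
            ((⌊4 * (((0 : ℕ) : ℝ) + 1) * K * (1 + |Real.log (Real.exp (-((k : ℝ) + 1)))|) /
                Real.exp (-((k : ℝ) + 1))⌋₊ : ℕ) : ℝ) ≤ ‖v‖ ∧
            ‖v‖ ≤ ((⌊4 * ((k : ℝ) + 1) * K * (1 + |Real.log (Real.exp (-((k : ℝ) + 1)))|) /
                Real.exp (-((k : ℝ) + 1))⌋₊ : ℕ) : ℝ) ∧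
            Real.exp (-(R * (Real.exp (-((k : ℝ) + 1)) * ‖v‖))) ≤
              (∫ U : GaugeConfig 4 (2 * S + 1) (Matrix.specialUnitaryGroup (Fin 3) ℂ),
                  ‖(diracMatrix U t).det‖ *
                    (∑ a : Fin 3, ∑ i : Fin 4, ∑ b : Fin 3, ∑ j : Fin 4,
                      ‖(diracMatrix U t)⁻¹ (quarkEquiv (f, (Torus.proj (2 * S + 1) 0, a, i)))
                        (quarkEquiv (f, (Torus.proj (2 * S + 1) v, b, j)))‖) ^ (1 / 2 : ℝ)
                  ∂(wilsonMeasure (fundamentalRep (Fin 3)) (afBeta Nf 1 (Real.exp (-((k : ℝ) + 1)))))) /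
                (∫ U : GaugeConfig 4 (2 * S + 1) (Matrix.specialUnitaryGroup (Fin 3) ℂ),
                  ‖(diracMatrix U t).det‖
                  ∂(wilsonMeasure (fundamentalRep (Fin 3)) (afBeta Nf 1 (Real.exp (-((k : ℝ) + 1)))))))


/-- The tree-vocabulary kernel IS the registered kernel `stub_noJumpKernel` (definitional). -/
theorem noJumpKernelTree_iff :
    NoJumpKernelTree ↔
      ∀ Nf : ℕ, Nf = 2 ∨ Nf = 3 → ∀ᶠ K in 𝓝[>] (0 : ℝ), ∀ M R₀ : ℝ, 0 < M → ∃ R : ℝ, ∀ᶠ k in atTop,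
        ∀ t t' : Fin Nf → ℝ, (∀ g, -1 ≤ t' g) → (∀ g, -1 < t g) →
          (∀ g, t g ≤ t' g + aSeq k * (M + 1) / zmSeq Nf k) → (∀ g, t' g ≤ t g + slabWidth Nf k) →
            (∀ g g', |t g - t g'| ≤ aSeq k * M / zmSeq Nf k) → (∀ g g', |t' g - t' g'| ≤ slabWidth Nf k) →
              ∀ f, ShellLight Nf K k R₀ t' f → ShellLight Nf K k R t f :=
  Iff.rfl

/-- Hence the tree-vocabulary kernel implies the planner's `stub_noJump` VERBATIM. -/
theorem noJump_of_noJumpKernelTree (hK : NoJumpKernelTree) :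
    ∀ Nf : ℕ, Nf = 2 ∨ Nf = 3 → ∀ᶠ K in 𝓝[>] (0 : ℝ), ∀ M : ℝ, 0 < M → ∃ R : ℝ, ∀ᶠ k in atTop,
      (floorSet Nf K k).Nonempty → -1 < thrMass Nf K k → ∀ t : Fin Nf → ℝ, (∀ f, thrMass Nf K k < t f) →
        (∀ f, t f ≤ thrMass Nf K k + aSeq k * M / zmSeq Nf k) → ∀ f, ShellLight Nf K k R t f :=
  noJump_of_noJumpKernel (noJumpKernelTree_iff.1 hK)

/-- **Tree-vocabulary twin of `stub_lowerPin`** (stub-worker, 2026-08-16): LOWER PIN FROM ONE LIGHT SHELL POINT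
(the whole open content of the planner's `stub_transport`).  For every sufficiently small threshold scale `K > 0` and every rate `R` there are
`s ∈ (0,1)`, `c₀ > 0`, `C₁`, `p` such that eventually in `k` — with `a_k := e^{-(k+1)}`,
`β_k := afBeta N_f 1 a_k`, shells `ℓ(q,k) := ⌊4(q+1)K(1+|log a_k|)/a_k⌋`, `L_k := ℓ(k,k)` — every bare
tuple `t > -1` (componentwise) which (a) obeys every shell bound `q ≤ k` on every torus `S ≥ L_k`
(`ℓ(q,k)^q (1+|β_k|)^q E_{|w|,β_k,S}[(Σ|G_f(0,v)|)^{1/2}] ≤ 1` at `‖v‖_∞ = ℓ(q,k)`) and (b) has, for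
every flavour, one light shell point (`E_{|w|,β_k,S*}[(Σ|G_f(0,v*)|)^{1/2}] ≥ e^{-R a_k ‖v*‖_∞}` for some
`S* ≥ L_k`, `ℓ(0,k) ≤ ‖v*‖_∞ ≤ L_k`) satisfies the lower pin
`c₀ e^{-C₁ a_k n}(n+1)^{-p} ≤ E_{|w|,β_k,S}[(Σ|G_f(0,n e₀)|)^s]` for all `S ≥ L_k`, all flavours, all
`n ≤ S`.  OPEN (lattice QCD; not in the literature as a theorem). -/
def LowerPinOfShellLight (Nf : ℕ) : Prop :=
  ∀ᶠ K in 𝓝[>] (0 : ℝ), ∀ R : ℝ, ∃ s c₀ C₁ p : ℝ, 0 < s ∧ s < 1 ∧ 0 < c₀ ∧ ∀ᶠ k : ℕ in atTop,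
    ∀ t : Fin Nf → ℝ, (∀ f, -1 < t f) →
      (∀ q : ℕ, q ≤ k → ∀ S : ℕ, ⌊4 * ((k : ℝ) + 1) * K * (1 + |Real.log (Real.exp (-((k : ℝ) + 1)))|) / Real.exp (-((k : ℝ) + 1))⌋₊ ≤ S →
        ∀ (f : Fin Nf) (v : Literature.Probability.LatticeModels.Site 4), v ∈ box 4 S →
          ‖v‖ = (⌊4 * ((q : ℝ) + 1) * K * (1 + |Real.log (Real.exp (-((k : ℝ) + 1)))|) / Real.exp (-((k : ℝ) + 1))⌋₊ : ℝ) →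
            (⌊4 * ((q : ℝ) + 1) * K * (1 + |Real.log (Real.exp (-((k : ℝ) + 1)))|) / Real.exp (-((k : ℝ) + 1))⌋₊ : ℝ) ^ q * (1 + |afBeta Nf 1 (Real.exp (-((k : ℝ) + 1)))|) ^ q *
                ((∫ U : GaugeConfig 4 (2 * S + 1) (Matrix.specialUnitaryGroup (Fin 3) ℂ),
                    ‖(diracMatrix U t).det‖ *
                      (∑ a : Fin 3, ∑ i : Fin 4, ∑ b : Fin 3, ∑ j : Fin 4,
                        ‖(diracMatrix U t)⁻¹ (quarkEquiv (f, (Torus.proj (2 * S + 1) 0, a, i)))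
                          (quarkEquiv (f, (Torus.proj (2 * S + 1) (v), b, j)))‖) ^ (1 / 2 : ℝ)
                    ∂(wilsonMeasure (fundamentalRep (Fin 3)) (afBeta Nf 1 (Real.exp (-((k : ℝ) + 1)))))) /
                  (∫ U : GaugeConfig 4 (2 * S + 1) (Matrix.specialUnitaryGroup (Fin 3) ℂ),
                    ‖(diracMatrix U t).det‖ ∂(wilsonMeasure (fundamentalRep (Fin 3)) (afBeta Nf 1 (Real.exp (-((k : ℝ) + 1))))))) ≤ 1) →
      (∀ f : Fin Nf, ∃ S : ℕ, ⌊4 * ((k : ℝ) + 1) * K * (1 + |Real.log (Real.exp (-((k : ℝ) + 1)))|) / Real.exp (-((k : ℝ) + 1))⌋₊ ≤ S ∧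
        ∃ v : Literature.Probability.LatticeModels.Site 4, v ∈ box 4 S ∧
          (⌊4 * (((0 : ℕ) : ℝ) + 1) * K * (1 + |Real.log (Real.exp (-((k : ℝ) + 1)))|) / Real.exp (-((k : ℝ) + 1))⌋₊ : ℝ) ≤ ‖v‖ ∧ ‖v‖ ≤ (⌊4 * ((k : ℝ) + 1) * K * (1 + |Real.log (Real.exp (-((k : ℝ) + 1)))|) / Real.exp (-((k : ℝ) + 1))⌋₊ : ℝ) ∧
            Real.exp (-(R * (Real.exp (-((k : ℝ) + 1)) * ‖v‖))) ≤
              (∫ U : GaugeConfig 4 (2 * S + 1) (Matrix.specialUnitaryGroup (Fin 3) ℂ),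
                  ‖(diracMatrix U t).det‖ *
                    (∑ a : Fin 3, ∑ i : Fin 4, ∑ b : Fin 3, ∑ j : Fin 4,
                      ‖(diracMatrix U t)⁻¹ (quarkEquiv (f, (Torus.proj (2 * S + 1) 0, a, i)))
                        (quarkEquiv (f, (Torus.proj (2 * S + 1) (v), b, j)))‖) ^ (1 / 2 : ℝ)
                  ∂(wilsonMeasure (fundamentalRep (Fin 3)) (afBeta Nf 1 (Real.exp (-((k : ℝ) + 1)))))) /
                (∫ U : GaugeConfig 4 (2 * S + 1) (Matrix.specialUnitaryGroup (Fin 3) ℂ),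
                  ‖(diracMatrix U t).det‖ ∂(wilsonMeasure (fundamentalRep (Fin 3)) (afBeta Nf 1 (Real.exp (-((k : ℝ) + 1))))))) →
      ∀ S : ℕ, ⌊4 * ((k : ℝ) + 1) * K * (1 + |Real.log (Real.exp (-((k : ℝ) + 1)))|) / Real.exp (-((k : ℝ) + 1))⌋₊ ≤ S → ∀ (f : Fin Nf) (n : ℕ), n ≤ S →
        c₀ * Real.exp (-(C₁ * (Real.exp (-((k : ℝ) + 1)) * n) + p * Real.log (n + 1))) ≤
          (∫ U : GaugeConfig 4 (2 * S + 1) (Matrix.specialUnitaryGroup (Fin 3) ℂ),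
              ‖(diracMatrix U t).det‖ *
                (∑ a : Fin 3, ∑ i : Fin 4, ∑ b : Fin 3, ∑ j : Fin 4,
                  ‖(diracMatrix U t)⁻¹ (quarkEquiv (f, (Torus.proj (2 * S + 1) 0, a, i)))
                    (quarkEquiv (f, (Torus.proj (2 * S + 1) (Pi.single 0 (n : ℤ)), b, j)))‖) ^ (s)
              ∂(wilsonMeasure (fundamentalRep (Fin 3)) (afBeta Nf 1 (Real.exp (-((k : ℝ) + 1)))))) /
            (∫ U : GaugeConfig 4 (2 * S + 1) (Matrix.specialUnitaryGroup (Fin 3) ℂ),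
              ‖(diracMatrix U t).det‖ ∂(wilsonMeasure (fundamentalRep (Fin 3)) (afBeta Nf 1 (Real.exp (-((k : ℝ) + 1))))))

/-- The tree-vocabulary twin IS the registered `stub_lowerPin` at each `N_f` (definitional). -/
theorem lowerPinOfShellLight_iff (Nf : ℕ) :
    LowerPinOfShellLight Nf ↔
      ∀ᶠ K in 𝓝[>] (0 : ℝ), ∀ R : ℝ, ∃ s c₀ C₁ p : ℝ, 0 < s ∧ s < 1 ∧ 0 < c₀ ∧
        ∀ᶠ k in atTop, ∀ t : Fin Nf → ℝ, (∀ f, -1 < t f) → Certified Nf K k t →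
          (∀ f, ShellLight Nf K k R t f) →
            ∀ S : ℕ, volSeq K k ≤ S → ∀ (f : Fin Nf) (n : ℕ), n ≤ S →
              c₀ * Real.exp (-(C₁ * (aSeq k * n) + p * Real.log (n + 1))) ≤
                fm Nf (betaSeq Nf k) t S f (Pi.single 0 (n : ℤ)) s :=
  Iff.rfl

/-- Hence the tree-vocabulary twin implies the planner's `stub_transport` VERBATIM. -/
theorem transport_of_lowerPinOfShellLight (h : ∀ Nf : ℕ, Nf = 2 ∨ Nf = 3 → LowerPinOfShellLight Nf) :
    ∀ Nf : ℕ, Nf = 2 ∨ Nf = 3 → ∀ᶠ K in 𝓝[>] (0 : ℝ), ∀ M R : ℝ, 0 < M →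
      ∃ s c₀ C₁ p : ℝ, 0 < s ∧ s < 1 ∧ 0 < c₀ ∧ ∀ᶠ k in atTop, (floorSet Nf K k).Nonempty → ∀ t : Fin Nf → ℝ,
        (∀ f, thrMass Nf K k < t f) → (∀ f, t f ≤ thrMass Nf K k + aSeq k * M / zmSeq Nf k) →
          (∀ f, ShellLight Nf K k R t f) →
            ∀ S : ℕ, volSeq K k ≤ S → ∀ (f : Fin Nf) (n : ℕ), n ≤ S →
              c₀ * Real.exp (-(C₁ * (aSeq k * n) + p * Real.log (n + 1))) ≤
                fm Nf (betaSeq Nf k) t S f (Pi.single 0 (n : ℤ)) s :=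
  transport_of_lowerPin fun Nf hNf => (lowerPinOfShellLight_iff Nf).1 (h Nf hNf)

/-- **Tree-vocabulary twin of `stub_signNonpos`** (lead, cycle 2): clause (iv) for the threshold witness on the
supercritical side, with the floor set `F = floorSet N_f K k` named by its defining equation (so the line-local
`thrMass = sInf F`, `IsGoodFloor`, `Certified`, `fm`, `aSeq`, `betaSeq`, `zmSeq`, `shellRadius`, `volSeq`,
`slabWidth` are all unfolded); `signNonposTree_iff` certifies it is the registered stub. Ready to be filed as a
named open input / `@[conjecture]` item. -/
def SignNonposTree : Prop :=
  ∀ Nf : ℕ, Nf = 2 ∨ Nf = 3 → ∀ᶠ K in 𝓝[>] (0 : ℝ), ∀ M : ℝ, 0 < M → ∀ᶠ k : ℕ in atTop, ∀ F : Set ℝ,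
    F = {u : ℝ | -1 ≤ u ∧ ∀ t' : Fin Nf → ℝ, (∀ f, u ≤ t' f) →
      (∀ f g, |t' f - t' g| ≤ (k : ℝ) * Real.exp (-((k : ℝ) + 1)) /
          Real.log (1 / Real.exp (-((k : ℝ) + 1)) ^ 2) ^ massExponent Nf) →
        ∀ q : ℕ, q ≤ k → ∀ S : ℕ,
          ⌊4 * ((k : ℝ) + 1) * K * (1 + |Real.log (Real.exp (-((k : ℝ) + 1)))|) / Real.exp (-((k : ℝ) + 1))⌋₊ ≤ S →
          ∀ (f : Fin Nf) (v : Literature.Probability.LatticeModels.Site 4), v ∈ box 4 S →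
            ‖v‖ = (⌊4 * ((q : ℝ) + 1) * K * (1 + |Real.log (Real.exp (-((k : ℝ) + 1)))|) /
                Real.exp (-((k : ℝ) + 1))⌋₊ : ℝ) →
              (⌊4 * ((q : ℝ) + 1) * K * (1 + |Real.log (Real.exp (-((k : ℝ) + 1)))|) /
                  Real.exp (-((k : ℝ) + 1))⌋₊ : ℝ) ^ q *
                (1 + |afBeta Nf 1 (Real.exp (-((k : ℝ) + 1)))|) ^ q *
                ((∫ U : GaugeConfig 4 (2 * S + 1) (Matrix.specialUnitaryGroup (Fin 3) ℂ),
                    ‖(diracMatrix U t').det‖ *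
                      (∑ a : Fin 3, ∑ i : Fin 4, ∑ b : Fin 3, ∑ j : Fin 4,
                        ‖(diracMatrix U t')⁻¹ (quarkEquiv (f, (Torus.proj (2 * S + 1) 0, a, i)))
                          (quarkEquiv (f, (Torus.proj (2 * S + 1) v, b, j)))‖) ^ (1 / 2 : ℝ)
                    ∂(wilsonMeasure (fundamentalRep (Fin 3)) (afBeta Nf 1 (Real.exp (-((k : ℝ) + 1)))))) /
                  (∫ U : GaugeConfig 4 (2 * S + 1) (Matrix.specialUnitaryGroup (Fin 3) ℂ),
                    ‖(diracMatrix U t').det‖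
                    ∂(wilsonMeasure (fundamentalRep (Fin 3)) (afBeta Nf 1 (Real.exp (-((k : ℝ) + 1))))))) ≤ 1} →
    F.Nonempty → -1 < sInf F → ∀ t : Fin Nf → ℝ, (∀ f, sInf F < t f) →
      (∀ f, t f ≤ sInf F + Real.exp (-((k : ℝ) + 1)) * M /
          Real.log (1 / Real.exp (-((k : ℝ) + 1)) ^ 2) ^ massExponent Nf) → (∃ f, t f ≤ 0) →
        (1 / 2 : ℝ) ≤
          ‖∫ U : GaugeConfig 4
                (2 * ⌊4 * ((k : ℝ) + 1) * K * (1 + |Real.log (Real.exp (-((k : ℝ) + 1)))|) /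
                    Real.exp (-((k : ℝ) + 1))⌋₊ + 1) (Matrix.specialUnitaryGroup (Fin 3) ℂ),
              (diracMatrix U t).det ∂(wilsonMeasure (fundamentalRep (Fin 3)) (afBeta Nf 1 (Real.exp (-((k : ℝ) + 1)))))‖ /
            (∫ U : GaugeConfig 4
                (2 * ⌊4 * ((k : ℝ) + 1) * K * (1 + |Real.log (Real.exp (-((k : ℝ) + 1)))|) /
                    Real.exp (-((k : ℝ) + 1))⌋₊ + 1) (Matrix.specialUnitaryGroup (Fin 3) ℂ),
              ‖(diracMatrix U t).det‖ ∂(wilsonMeasure (fundamentalRep (Fin 3)) (afBeta Nf 1 (Real.exp (-((k : ℝ) + 1))))))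

/-- The tree-vocabulary twin IS the registered `stub_signNonpos` (the floor set is named by its defining
equation; everything else is definitional unfolding). -/
theorem signNonposTree_iff :
    SignNonposTree ↔
      ∀ Nf : ℕ, Nf = 2 ∨ Nf = 3 → ∀ᶠ K in 𝓝[>] (0 : ℝ), ∀ M : ℝ, 0 < M → ∀ᶠ k in atTop,
        (floorSet Nf K k).Nonempty → -1 < thrMass Nf K k → ∀ t : Fin Nf → ℝ, (∀ f, thrMass Nf K k < t f) →
          (∀ f, t f ≤ thrMass Nf K k + aSeq k * M / zmSeq Nf k) → (∃ f, t f ≤ 0) →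
            (1 / 2 : ℝ) ≤
              ‖∫ U : GaugeConfig 4 (2 * volSeq K k + 1) (Matrix.specialUnitaryGroup (Fin 3) ℂ),
                  (diracMatrix U t).det ∂(wilsonMeasure (fundamentalRep (Fin 3)) (betaSeq Nf k))‖ /
                (∫ U : GaugeConfig 4 (2 * volSeq K k + 1) (Matrix.specialUnitaryGroup (Fin 3) ℂ),
                  ‖(diracMatrix U t).det‖ ∂(wilsonMeasure (fundamentalRep (Fin 3)) (betaSeq Nf k))) := by
  refine forall₂_congr fun Nf _ => Filter.eventually_congr (Eventually.of_forall fun K => ?_)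
  refine forall₂_congr fun M _ => Filter.eventually_congr (Eventually.of_forall fun k => ?_)
  constructor
  · intro h
    exact h (floorSet Nf K k) rfl
  · rintro h F rfl
    exact h

end Summit.QuantumFields.QCD.Cruxes.OneScaleTrajectory.ThresholdTunedWitness

end
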